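import Summits.KontsevichZagierPeriods.KontsevichZagierPeriods.Theses.UnfoldedStokes
import Literature.NumberTheory.Transcendental.KZKernelConjectureForms
import Literature.NumberTheory.Transcendental.KZCalculusProofs
import Literature.NumberTheory.Transcendental.KZGroundingRelations
import Literature.NumberTheory.Transcendental.KZVolumeConjectureProofs
import Literature.NumberTheory.Transcendental.KZSemialgebraicComplex
import Literature.NumberTheory.Transcendental.SemialgebraicMapsProofs
import Literature.NumberTheory.Transcendental.SemialgebraicAlgebraicPoints
import Summits.KontsevichZagierPeriods.KontsevichZagierPeriods.Theorems.UnfoldedStokesUnfoldedStokesSquare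
import Summits.KontsevichZagierPeriods.KontsevichZagierPeriods.Theorems.UnfoldedStokesStokesGenerationStubCubifyKernel
import Summits.KontsevichZagierPeriods.KontsevichZagierPeriods.Theorems.UnfoldedStokesStokesGenerationStubFibrewiseStokesCalibration
import Summits.KontsevichZagierPeriods.KontsevichZagierPeriods.Theorems.UnfoldedStokesStokesGenerationStubRungMixedBaker
import Summits.KontsevichZagierPeriods.KontsevichZagierPeriods.Theorems.UnfoldedStokesStokesGenerationStubRungDlogValue
import Summits.KontsevichZagierPeriods.KontsevichZagierPeriods.Theorems.UnfoldedStokesStokesGenerationStubRungDlogProd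
import Summits.KontsevichZagierPeriods.KontsevichZagierPeriods.Theorems.UnfoldedStokesStokesGenerationStubRungArctanFTC
import Summits.KontsevichZagierPeriods.KontsevichZagierPeriods.Theorems.UnfoldedStokesStokesGenerationFibrewiseKernelAlgKInterval
import Summits.KontsevichZagierPeriods.KontsevichZagierPeriods.Theorems.UnfoldedStokesStokesGenerationFibrewiseDecomposableAPI
import Summits.KontsevichZagierPeriods.KontsevichZagierPeriods.Theorems.UnfoldedStokesStokesGenerationFibrewiseRungIsotopy2
import Summits.KontsevichZagierPeriods.KontsevichZagierPeriods.Theorems.UnfoldedStokesStokesGenerationFibrewiseRungSubintervalDlog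
import Summits.KontsevichZagierPeriods.KontsevichZagierPeriods.Theorems.UnfoldedStokesStokesGenerationFibrewiseClosureSum
import Summits.KontsevichZagierPeriods.KontsevichZagierPeriods.Theorems.UnfoldedStokesStokesGenerationFibrewiseClosureCongr
import Summits.KontsevichZagierPeriods.KontsevichZagierPeriods.Theorems.UnfoldedStokesStokesGenerationFibrewiseClosureMulFresh
import Summits.KontsevichZagierPeriods.KontsevichZagierPeriods.Theorems.HurwitzMicroSectorsNormalFormPrincipleAlgSplitK5Kit
import Summits.KontsevichZagierPeriods.KontsevichZagierPeriods.Theorems.UnfoldedStokesStokesGenerationStubLoopAngleExp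
import Summits.KontsevichZagierPeriods.KontsevichZagierPeriods.Theorems.UnfoldedStokesStokesGenerationStubLoopZPow
import Summits.KontsevichZagierPeriods.KontsevichZagierPeriods.Theorems.UnfoldedStokesStokesGenerationStubRawPartialFractions
import Summits.KontsevichZagierPeriods.KontsevichZagierPeriods.Theorems.UnfoldedStokesStokesGenerationStubQuadPoleReduction
import Summits.KontsevichZagierPeriods.KontsevichZagierPeriods.Theorems.UnfoldedStokesStokesGenerationStubMixedValue
import Summits.KontsevichZagierPeriods.KontsevichZagierPeriods.Theorems.UnfoldedStokesStokesGenerationStubClampedNewtonLeibniz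
import Summits.KontsevichZagierPeriods.KontsevichZagierPeriods.Theorems.UnfoldedStokesStokesGenerationFibrewiseRungDimOneRational
import Summits.KontsevichZagierPeriods.KontsevichZagierPeriods.Theorems.UnfoldedStokesStokesGenerationStubPlaceCoords
import Summits.KontsevichZagierPeriods.KontsevichZagierPeriods.Theorems.UnfoldedStokesStokesGenerationStubValueOneCoord
import Summits.KontsevichZagierPeriods.KontsevichZagierPeriods.Theorems.UnfoldedStokesStokesGenerationStubExactSwap
import Summits.KontsevichZagierPeriods.KontsevichZagierPeriods.Theorems.UnfoldedStokesStokesGenerationStubAngTransport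
import Summits.KontsevichZagierPeriods.KontsevichZagierPeriods.Theorems.UnfoldedStokesStokesGenerationStubParamHalfAngleCertificate
import Summits.KontsevichZagierPeriods.KontsevichZagierPeriods.Theorems.UnfoldedStokesStokesGenerationStubLoopLinearFactors
import Summits.KontsevichZagierPeriods.KontsevichZagierPeriods.Theorems.UnfoldedStokesStokesGenerationStubZsmulSumCube
import Summits.KontsevichZagierPeriods.KontsevichZagierPeriods.Theorems.UnfoldedStokesStokesGenerationStubSaDlogProd
import Summits.KontsevichZagierPeriods.KontsevichZagierPeriods.Theorems.UnfoldedStokesStokesGenerationStubSaDlogValue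
import Summits.KontsevichZagierPeriods.KontsevichZagierPeriods.Theorems.UnfoldedStokesStokesGenerationStubSaLoopAngleExp
import Summits.KontsevichZagierPeriods.KontsevichZagierPeriods.Theorems.UnfoldedStokesStokesGenerationStubSaPartition
import Summits.KontsevichZagierPeriods.KontsevichZagierPeriods.Theorems.UnfoldedStokesStokesGenerationStubSaArctanFTC
import Summits.KontsevichZagierPeriods.KontsevichZagierPeriods.Theorems.UnfoldedStokesStokesGenerationStubSaClampedAngularCertificate
import Summits.KontsevichZagierPeriods.KontsevichZagierPeriods.Theorems.UnfoldedStokesStokesGenerationStubSaMixedValue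
import Summits.KontsevichZagierPeriods.KontsevichZagierPeriods.Theorems.UnfoldedStokesStokesGenerationStubSaLoopZPow
import Summits.KontsevichZagierPeriods.KontsevichZagierPeriods.Theorems.UnfoldedStokesStokesGenerationStubSaSwapTransport
import Summits.KontsevichZagierPeriods.KontsevichZagierPeriods.Theorems.UnfoldedStokesStokesGenerationFibrewiseRungAngSwap
import Summits.KontsevichZagierPeriods.KontsevichZagierPeriods.Theorems.UnfoldedStokesStokesGenerationFibrewiseRungSeparated
import Summits.KontsevichZagierPeriods.KontsevichZagierPeriods.Theorems.UnfoldedStokesStokesGenerationFibrewiseRungSaDlogSector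
import Summits.KontsevichZagierPeriods.KontsevichZagierPeriods.Theorems.UnfoldedStokesStokesGenerationFibrewiseRungSaAngularSector
import Summits.KontsevichZagierPeriods.KontsevichZagierPeriods.Theorems.UnfoldedStokesStokesGenerationFibrewiseRungSaDlogSwap
import Summits.KontsevichZagierPeriods.KontsevichZagierPeriods.Theorems.UnfoldedStokesStokesGenerationFibrewiseRungSaMixed
import Summits.KontsevichZagierPeriods.KontsevichZagierPeriods.Theorems.UnfoldedStokesStokesGenerationStubClampedLoopPiece
import Summits.KontsevichZagierPeriods.KontsevichZagierPeriods.Theorems.UnfoldedStokesStokesGenerationStubKinkedAngTransport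
import Summits.KontsevichZagierPeriods.KontsevichZagierPeriods.Theorems.UnfoldedStokesStokesGenerationStubBoxToCube
import Summits.KontsevichZagierPeriods.KontsevichZagierPeriods.Theorems.UnfoldedStokesStokesGenerationFibrewiseRungSaAngSwap
import Summits.KontsevichZagierPeriods.KontsevichZagierPeriods.Theorems.UnfoldedStokesStokesGenerationFibrewiseRungSaSeparated
import Summits.KontsevichZagierPeriods.KontsevichZagierPeriods.Theorems.UnfoldedStokesStokesGenerationFibrewiseRungSeparatedBox
import Summits.KontsevichZagierPeriods.KontsevichZagierPeriods.Theorems.UnfoldedStokesStokesGenerationFibrewiseRungScaling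
import Summits.KontsevichZagierPeriods.KontsevichZagierPeriods.Theorems.UnfoldedStokesStokesGenerationFibrewiseRungScalingSwaps
import Summits.KontsevichZagierPeriods.KontsevichZagierPeriods.Theorems.UnfoldedStokesStokesGenerationFibrewiseRungPermutation
import Summits.KontsevichZagierPeriods.KontsevichZagierPeriods.Theorems.UnfoldedStokesStokesGenerationFibrewiseRungReparam
import Summits.KontsevichZagierPeriods.KontsevichZagierPeriods.Theorems.UnfoldedStokesStokesGenerationFibrewiseRungSubdivision
import Literature.Analysis.Calculus.JacobianNullLagrangian
import Summits.KontsevichZagierPeriods.KontsevichZagierPeriods.Theorems.UnfoldedStokesStokesGenerationStubAdjugateBlockTriangular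
import Summits.KontsevichZagierPeriods.KontsevichZagierPeriods.Theorems.UnfoldedStokesStokesGenerationStubAdjugateMulVecFace
import Summits.KontsevichZagierPeriods.KontsevichZagierPeriods.Theorems.UnfoldedStokesStokesGenerationStubEllipticTranslationDeriv
import Mathlib.MeasureTheory.Constructions.Pi
import Mathlib.Topology.Algebra.Polynomial
import Mathlib.Analysis.SpecialFunctions.Integrals.Basic
import Summits.KontsevichZagierPeriods.KontsevichZagierPeriods.Theorems.UnfoldedStokesStokesGenerationStubJacobianMatrixSuspension
import Summits.KontsevichZagierPeriods.KontsevichZagierPeriods.Theorems.UnfoldedStokesStokesGenerationStubSuspensionRegularity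
import Summits.KontsevichZagierPeriods.KontsevichZagierPeriods.Theorems.UnfoldedStokesStokesGenerationStubSuspensionSemialgebraic
import Summits.KontsevichZagierPeriods.KontsevichZagierPeriods.Theorems.UnfoldedStokesStokesGenerationStubDiagReparam
import Summits.KontsevichZagierPeriods.KontsevichZagierPeriods.Theorems.UnfoldedStokesStokesGenerationStubPolylogDuplication
import Summits.KontsevichZagierPeriods.KontsevichZagierPeriods.Theorems.UnfoldedStokesStokesGenerationStubIntervalTransport
import Summits.KontsevichZagierPeriods.KontsevichZagierPeriods.Theorems.UnfoldedStokesStokesGenerationStubLandenPartOne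
import Summits.KontsevichZagierPeriods.KontsevichZagierPeriods.Theorems.UnfoldedStokesStokesGenerationStubLandenPartTwo
import Summits.KontsevichZagierPeriods.KontsevichZagierPeriods.Theorems.UnfoldedStokesStokesGenerationStubLandenPartThree
import Summits.KontsevichZagierPeriods.KontsevichZagierPeriods.Theorems.UnfoldedStokesStokesGenerationStubLandenLeftovers
import Summits.KontsevichZagierPeriods.KontsevichZagierPeriods.Theorems.UnfoldedStokesStokesGenerationStubPolylogArgHomotopy
import Summits.KontsevichZagierPeriods.KontsevichZagierPeriods.Theorems.UnfoldedStokesStokesGenerationStubLogProductHomotopy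
import Summits.KontsevichZagierPeriods.KontsevichZagierPeriods.Theorems.UnfoldedStokesStokesGenerationStubHillRelationA
import Summits.KontsevichZagierPeriods.KontsevichZagierPeriods.Theorems.UnfoldedStokesStokesGenerationStubHillRelationB
import Summits.KontsevichZagierPeriods.KontsevichZagierPeriods.Theorems.UnfoldedStokesStokesGenerationFibrewiseRungFiveTerm
import Summits.KontsevichZagierPeriods.KontsevichZagierPeriods.Theorems.UnfoldedStokesStokesGenerationStubLogPairHomotopy
import Summits.KontsevichZagierPeriods.KontsevichZagierPeriods.Theorems.UnfoldedStokesStokesGenerationFibrewiseRungEulerReflection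
import Summits.KontsevichZagierPeriods.KontsevichZagierPeriods.Theorems.UnfoldedStokesStokesGenerationStubEllipticTranslationRelator
import Summits.KontsevichZagierPeriods.KontsevichZagierPeriods.Theorems.UnfoldedStokesStokesGenerationFibrewiseRungPullback
import Summits.KontsevichZagierPeriods.KontsevichZagierPeriods.Theorems.UnfoldedStokesStokesGenerationFibrewiseRungLanden

/-!
# `StokesGeneration` (stmt-KontsevichZagierPeriods-3586) — line `fibrewise-stokes` (crux-strategist)

STRATEGIST LINE for the crux `StokesGeneration` of route UnfoldedStokes (thesis part B; the crux is
kernel-checked equivalent to the summit, `Negative/IffSummit.lean`). It is the cube / type-(a) cut of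
the lead's line `Sketch` (card cube-type-a-generation) **transposed from Ayoub's analytic class
`𝒪_{ℚ̄-alg}(𝔻̄^∞)` to the regularity class of the Kontsevich–Zagier calculus itself** (bounded
`ℚ`-semialgebraic integrands on the closed cube; Newton–Leibniz primitives continuous on closed
coordinate fibres and differentiable off a fibrewise-finite semialgebraic kink set — exactly the
fibrewise regularity of `KZ.newtonLeibnizRel`). The point of the transposition: the lead's STUCK stub
`stub_cubeNashNormalForm` (N₁ = item stmt-3574, embedded resolution of singularities in ambient
dimension ≥ 3, Hironaka-class, not in Mathlib) is needed ONLY to enter Ayoub's closed-polydisc class;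
in KZ's own class the normal form is resolution-free and essentially in the tree (Viu-Sos' reduction
`KZ.exists_sub_isBounded`, slabs, gluing), so this line has exactly ONE residual of summit strength and
no formalisation mountain in front of it.

Registered stubs (three; composition `StokesGeneration_of` kernel-checked, sorries only in stubs).
RESHAPE (lead c1, cycle 3): S1 LANDED (p120281); S2/S3 restated with fibrewise-CONTINUOUS primitives
`G` (kinks across `K` allowed, no jumps) and the explicit fibre datum `G|_{xᵢ=1} − G|_{xᵢ=0}` in place of
an a.e. fibre mean `m` — equivalent to the strategist's jump version (subtract the semialgebraic jump
staircase; see `FibrewiseStokesGeneration`), and it makes S3 provable without one-sided limits.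
Original descriptions:

* `stub_cubifyKernel` (S1, provable now, M): every formal combination `x` is `≡` modulo the moves to
  ONE closed-cube representation `[[0,1]^M, h]` with `h` bounded (and, being an integrand,
  `ℚ`-semialgebraic and integrable). Tools: `KZ.exists_integralRep_sub_holds`,
  `KZ.exists_sub_isBounded` (×2: four bounded volumes), affine contraction into disjoint sub-boxes of
  the unit cube (rule (2), constant Jacobian), slabs to a common dimension, gluing (rule (1a)),
  extension by `0`, integrand additivity. No resolution, no Nash regularity.
* `stub_fibrewiseStokesGeneration` (S2, THE RESIDUAL, summit strength): a bounded cube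
  representation of value `0` is, after padding by dummy variables and off a null `ℚ`-semialgebraic
  set, a finite sum of FIBREWISE STOKES ELEMENTS `D − m`: `D` the derivative along a coordinate `i`
  of a bounded `ℚ`-semialgebraic `G` off a semialgebraic set `K` with finite `i`-fibres (JUMPS and
  KINKS of `G` across `K` allowed, discontinuities of `G` along hypersurfaces containing the
  `i`-direction allowed), `m` the fibre mean of `D` (fibre-constant, bounded, semialgebraic; so
  `m = G|_{xᵢ=1⁻} − G|_{xᵢ=0⁺} − Σ jumps`, and for `G` continuous along fibres `D − m` is Ayoub's
  type-(a) element `∂ᵢG − G|_{xᵢ=1} + G|_{xᵢ=0}`). This is Ayoub's Conjecture 1.1 [Ayoub 2015;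
  Fresán 2024, Conj. 3.5] transposed to KZ's regularity class — OUR VARIANT (not in print):
  `S2 ⟹ summit` is this file (`summit_of_subs`); `summit ⟹ S2` is expected by cubification of
  chains (each of the moves (1a), (1b), (2), (3) becomes a fibrewise combination on the cube:
  (3) is ONE element with the clamped primitive, scissors along a tilted hypersurface `{ℓ = c}` are
  the kinked primitive `|ℓ − c|`, change of variables is a semialgebraic isotopy in a padded cube +
  the continuity equation + one round of jump-sheet bookkeeping; cf. [Ayoub 2015, Rem. 1.5; Fresán
  2024, Rem. 3.7] for the analytic class) but is NOT claimed and NOT used. Honours the Disproof: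
  uses `eval x = 0` (via `t.value = 0`), quantifies over all numbers of variables
  (`kernelElt_not_stokes_one_variable`), all data `ℚ`-semialgebraic (no real-coefficient version).
* `stub_fibrewiseStokesCalibration` (S3, provable now, M/L): every fibrewise Stokes element is a
  relation of the four-move calculus — generalises the LANDED `stub_cubeCalibration` (p97569: `G` of
  class `C¹` on a neighbourhood of the closed cube) to kinked and jumping primitives: permute `i`
  last (`KZ.of_sub_of_mem_relations_perm`), cylindrical decomposition of the cube adapted to `K`
  (`IsSemialgebraic.exists_cylindricalDecomposition_holds`, proved in the tree), one Newton–Leibniz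
  move per band between consecutive sections of `K` (primitive: the continuous extension of `G` from
  the open band; one-sided limits exist since `G` is bounded semialgebraic), base terms summed (rule
  (1b)) and identified with `m` almost everywhere (fibrewise FTC + the a.e. side condition, then
  null-set excision), re-inflation by a slab — the pattern of `KZ.of_sub_of_mem_relations_groundLast`
  with primitive `G` in place of `t`.

Sorry-free glue proved here: lifting a closed-cube representation to higher dimension (`liftCube`,
adapted from the lead's `Lines/Sketch.lean`), null-set excision (`of_mem_relations_of_volume_zero`,
`of_sub_sum_mem_relations_of_eqOn_off_null`), and the composition in two forms:
`StokesGeneration_of_subs : CubifyKernel → FibrewiseStokesGeneration → FibrewiseStokesCalibration →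
StokesGeneration` (the decomposition theorem) and `StokesGeneration_of : StokesGeneration` (from the
three stubs).

References: M. Kontsevich, D. Zagier, *Periods* (2001), §1.2; J. Ayoub, Ann. of Math. 181 (2015),
Conj. 1.1, Rem. 1.2, Rem. 1.5; J. Fresán, *Une introduction aux périodes* (2024), Conj. 3.5,
Rem. 3.6–3.7; J. Viu-Sos, IJNT 17 (2021), Thm. 1.1; J. Cresson, J. Viu-Sos, JTNB 34 (2022), §1–2.
-/

noncomputable section

set_option linter.dupNamespace false

namespace Summit.KontsevichZagierPeriods.KontsevichZagierPeriods.Cruxes.StokesGeneration.FibrewiseStokes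

open MeasureTheory Set
open Literature.NumberTheory.Transcendental
open Literature.NumberTheory.Transcendental.KZ
open Literature.ModelTheory.ExponentialFields (IsSemialgebraic)
open Summit.KontsevichZagierPeriods.KontsevichZagierPeriods.Theses.UnfoldedStokes (StokesGeneration)
open scoped Polynomial
open Literature.Analysis.Calculus (jacobianMatrix jacCofactor piolaField)

/-! ## The three pieces, as named propositions (decomposition form) -/

/-- **S1 — one-cube normal form (resolution-free).** Every formal `ℤ`-combination of integral
representations is, modulo the moves, ONE representation on a closed unit cube with bounded
integrand. [cite: KontsevichZagier2001, §1.2] -/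
def CubifyKernel : Prop :=
  ∀ x : FormalRep, ∃ (M : ℕ) (t : IntegralRep M),
    t.domain = Set.pi Set.univ (fun _ : Fin M => Set.Icc (0:ℝ) 1) ∧
    (∃ B : ℝ, ∀ z ∈ t.domain, |t.integrand z| ≤ B) ∧
    x - of t ∈ relations

/-- **S2 — fibrewise Stokes generation (the residual; Ayoub's Conjecture 1.1 transposed to the
regularity class of the KZ calculus; summit strength).** A bounded closed-cube representation of
value `0` is, after padding by dummy variables, off a null `ℚ`-semialgebraic set, a finite sum of
FIBREWISE STOKES ELEMENTS `D − (G|_{xᵢ=1} − G|_{xᵢ=0})`: `G` bounded, `ℚ`-semialgebraic on the cube,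
CONTINUOUS along each closed coordinate-`i` fibre, and differentiable along the fibre with derivative
`D` at every interior point off a `ℚ`-semialgebraic set `K` with finite `i`-fibres (KINKS of `G` across
`K` allowed). RESHAPED by the lead (cycle 3) from the strategist's version with fibrewise JUMPS and a
fibre-mean `m`: the two are equivalent — a jumping primitive `G` with a.e.-mean `m` is replaced by the
fibrewise-continuous `G̃ = G − Σ_{c_k < xᵢ} jump_k` (the jump loci are section graphs of a cylindrical
decomposition adapted to `K`, the jumps are one-sided limits of a bounded semialgebraic function, hence
`ℚ`-semialgebraic by Tarski–Seidenberg), which has the same a.e. fibre derivative `D` and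
`G̃|₁ − G̃|₀ = G|_{1⁻} − G|_{0⁺} − Σ jumps = ∫₀¹ D = m` a.e.; so nothing is lost, and the calibration S3
needs no one-sided limits. OUR VARIANT of [Ayoub 2015, Conj. 1.1] / [Fresán 2024, Conj. 3.5]; not in
print. [cite: Ayoub2015, Conj. 1.1] -/
def FibrewiseStokesGeneration : Prop :=
  ∀ (M : ℕ) (t : IntegralRep M), t.domain = Set.pi Set.univ (fun _ : Fin M => Set.Icc (0:ℝ) 1) →
    (∃ B : ℝ, ∀ z ∈ t.domain, |t.integrand z| ≤ B) → t.value = 0 →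
    ∃ (M' : ℕ) (hMM' : M ≤ M') (J : ℕ) (i : Fin J → Fin M') (G D : Fin J → (Fin M' → ℝ) → ℝ)
      (K : Fin J → Set (Fin M' → ℝ)) (q : Fin J → IntegralRep M') (Z : Set (Fin M' → ℝ)),
      (∀ j, IsSemialgebraicFunOn ℚ (Set.pi Set.univ (fun _ : Fin M' => Set.Icc (0:ℝ) 1)) (G j) ∧
        IsSemialgebraicFunOn ℚ (Set.pi Set.univ (fun _ : Fin M' => Set.Icc (0:ℝ) 1)) (D j) ∧
        IsSemialgebraic ℚ (K j) ∧
        (∃ B : ℝ, ∀ x ∈ Set.pi Set.univ (fun _ : Fin M' => Set.Icc (0:ℝ) 1), |(G j) x| ≤ B) ∧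
        (∀ x ∈ Set.pi Set.univ (fun _ : Fin M' => Set.Icc (0:ℝ) 1), Set.Finite {s : ℝ | Function.update x (i j) s ∈ (K j)}) ∧
        (∀ x ∈ Set.pi Set.univ (fun _ : Fin M' => Set.Icc (0:ℝ) 1), ContinuousOn (fun s : ℝ => (G j) (Function.update x (i j) s)) (Set.Icc (0:ℝ) 1)) ∧
        (∀ x ∈ Set.pi Set.univ (fun _ : Fin M' => Set.Icc (0:ℝ) 1), x ∉ (K j) → x (i j) ∈ Set.Ioo (0:ℝ) 1 →
          HasDerivAt (fun s : ℝ => (G j) (Function.update x (i j) s)) ((D j) x) (x (i j)))) ∧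
      (∀ j, (q j).domain = Set.pi Set.univ (fun _ : Fin M' => Set.Icc (0:ℝ) 1) ∧
        ∀ x ∈ Set.pi Set.univ (fun _ : Fin M' => Set.Icc (0:ℝ) 1), (q j).integrand x =
          D j x - (G j (Function.update x (i j) 1) - G j (Function.update x (i j) 0))) ∧
      IsSemialgebraic ℚ Z ∧ volume Z = 0 ∧
      ∀ x ∈ Set.pi Set.univ (fun _ : Fin M' => Set.Icc (0:ℝ) 1), x ∉ Z →
        t.integrand (fun l => x (Fin.castLE hMM' l)) = ∑ j, (q j).integrand x

/-- **S3 — fibrewise Stokes calibration (provable).** Every fibrewise Stokes element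
`[[0,1]^{M'}, D − (G|_{xᵢ=1} − G|_{xᵢ=0})]` (data as in S2) is a relation of the four-move calculus:
permute `i` last (rule (2), permutation matrix), cylindrical decomposition of the base adapted to
`K ∪ {xᵢ ∈ {0,1}}` (finite fibres ⇒ only graphs over each cell, among them the faces `xᵢ = 0, 1`),
one Newton–Leibniz move per band between CONSECUTIVE adapted sections with primitive `G` itself
(continuous on the closed fibre, derivative `D` inside), base terms telescoping to
`G(·,1) − G(·,0)` (rule (1b)), cylinders glued (rule (1a), graphs null), re-inflation by a slab
(rule (3)). Generalises the landed `stub_cubeCalibration` (p97569, `G` of class `C¹` near the cube).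
[cite: KontsevichZagier2001, §1.2 rule (3)] -/
def FibrewiseStokesCalibration : Prop :=
  ∀ (M' : ℕ) (i : Fin M') (G D : (Fin M' → ℝ) → ℝ) (K : Set (Fin M' → ℝ)),
    IsSemialgebraicFunOn ℚ (Set.pi Set.univ (fun _ : Fin M' => Set.Icc (0:ℝ) 1)) G →
      IsSemialgebraicFunOn ℚ (Set.pi Set.univ (fun _ : Fin M' => Set.Icc (0:ℝ) 1)) D →
      IsSemialgebraic ℚ K →
      (∃ B : ℝ, ∀ x ∈ Set.pi Set.univ (fun _ : Fin M' => Set.Icc (0:ℝ) 1), |G x| ≤ B) →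
      (∀ x ∈ Set.pi Set.univ (fun _ : Fin M' => Set.Icc (0:ℝ) 1), Set.Finite {s : ℝ | Function.update x i s ∈ K}) →
      (∀ x ∈ Set.pi Set.univ (fun _ : Fin M' => Set.Icc (0:ℝ) 1), ContinuousOn (fun s : ℝ => G (Function.update x i s)) (Set.Icc (0:ℝ) 1)) →
      (∀ x ∈ Set.pi Set.univ (fun _ : Fin M' => Set.Icc (0:ℝ) 1), x ∉ K → x i ∈ Set.Ioo (0:ℝ) 1 →
        HasDerivAt (fun s : ℝ => G (Function.update x i s)) (D x) (x i)) →
    ∀ q : IntegralRep M', q.domain = Set.pi Set.univ (fun _ : Fin M' => Set.Icc (0:ℝ) 1) →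
      (∀ x ∈ Set.pi Set.univ (fun _ : Fin M' => Set.Icc (0:ℝ) 1), q.integrand x = D x - (G (Function.update x i 1) - G (Function.update x i 0))) →
      of q ∈ relations

/-! ## Registered stubs -/

/-! LANDED: `stub_cubifyKernel` (S1) — p120281, `Theorems/UnfoldedStokesStokesGenerationStubCubifyKernel.lean`
(imported above, same namespace, exact registered signature). -/

/-- STUB (S2) `FibrewiseStokesGeneration`, spelled out — THE RESIDUAL (summit strength); reshaped
(fibrewise-continuous primitives, see the docstring of `FibrewiseStokesGeneration`).
[cite: Ayoub2015, Conj. 1.1] -/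
theorem stub_fibrewiseStokesGeneration :
    ∀ (M : ℕ) (t : IntegralRep M), t.domain = Set.pi Set.univ (fun _ : Fin M => Set.Icc (0:ℝ) 1) →
      (∃ B : ℝ, ∀ z ∈ t.domain, |t.integrand z| ≤ B) → t.value = 0 →
      ∃ (M' : ℕ) (hMM' : M ≤ M') (J : ℕ) (i : Fin J → Fin M') (G D : Fin J → (Fin M' → ℝ) → ℝ)
        (K : Fin J → Set (Fin M' → ℝ)) (q : Fin J → IntegralRep M') (Z : Set (Fin M' → ℝ)),
        (∀ j, IsSemialgebraicFunOn ℚ (Set.pi Set.univ (fun _ : Fin M' => Set.Icc (0:ℝ) 1)) (G j) ∧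
          IsSemialgebraicFunOn ℚ (Set.pi Set.univ (fun _ : Fin M' => Set.Icc (0:ℝ) 1)) (D j) ∧
          IsSemialgebraic ℚ (K j) ∧
          (∃ B : ℝ, ∀ x ∈ Set.pi Set.univ (fun _ : Fin M' => Set.Icc (0:ℝ) 1), |(G j) x| ≤ B) ∧
          (∀ x ∈ Set.pi Set.univ (fun _ : Fin M' => Set.Icc (0:ℝ) 1), Set.Finite {s : ℝ | Function.update x (i j) s ∈ (K j)}) ∧
          (∀ x ∈ Set.pi Set.univ (fun _ : Fin M' => Set.Icc (0:ℝ) 1), ContinuousOn (fun s : ℝ => (G j) (Function.update x (i j) s)) (Set.Icc (0:ℝ) 1)) ∧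
          (∀ x ∈ Set.pi Set.univ (fun _ : Fin M' => Set.Icc (0:ℝ) 1), x ∉ (K j) → x (i j) ∈ Set.Ioo (0:ℝ) 1 →
            HasDerivAt (fun s : ℝ => (G j) (Function.update x (i j) s)) ((D j) x) (x (i j)))) ∧
        (∀ j, (q j).domain = Set.pi Set.univ (fun _ : Fin M' => Set.Icc (0:ℝ) 1) ∧
          ∀ x ∈ Set.pi Set.univ (fun _ : Fin M' => Set.Icc (0:ℝ) 1), (q j).integrand x =
            D j x - (G j (Function.update x (i j) 1) - G j (Function.update x (i j) 0))) ∧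
        IsSemialgebraic ℚ Z ∧ volume Z = 0 ∧
        ∀ x ∈ Set.pi Set.univ (fun _ : Fin M' => Set.Icc (0:ℝ) 1), x ∉ Z →
          t.integrand (fun l => x (Fin.castLE hMM' l)) = ∑ j, (q j).integrand x := by
  sorry

/-! LANDED: `stub_fibrewiseStokesCalibration` (S3, reshaped) — `Theorems/UnfoldedStokesStokesGenerationStubFibrewiseStokesCalibration.lean`
(+ helpers …StubFibrewiseCalibrationBands p120892, …StubFibrewiseCalibrationLast), imported above. -/


/-! ## Rungs 1–7 (leads c2, c4): LANDED — imported from the tree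

All sector assemblies of the line are tree theorems now (same namespace, imported above through
`…FibrewiseDecomposableAPI`, `…FibrewiseRungIsotopy2`, `…FibrewiseRungSubintervalDlog`); the skeleton no longer
carries copies (lead c5 cleanup, so that the closure algebra and the dictionary can be imported):
* rung 1 `fibrewiseStokesGeneration_simpleRealPoles` (Baker sector) — p125207 `…FibrewiseRungSimpleRealPoles.lean`
  (stubs R1 `stub_rungValue` p124409, R2 `stub_rungCertificate` p124720, R3 `stub_rungLogDerivProd` p124502);
* rung 2 `fibrewiseStokesGeneration_dlogSector` (dlog sector with exact part) — p126066 `…FibrewiseRungDlogSector.lean`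
  (R4 `stub_rungInhomBaker` p125029, R5 `stub_rungDlogProd` p125139, R6 `stub_rungDlogValue` p125027,
  R7 `stub_rungExactElement` p125062);
* rung 3 `fibrewiseStokesGeneration_angularLoop` (closed angular loops, `Re > 0`) — p126092 (R9
  `stub_rungAngularCertificate` p125742; R8 `stub_rungMixedBaker` p126025);
* rung 4 `fibrewiseStokesGeneration_angularSector` (full angular sector, root-free) — p128548 (R10 p128185, R11 p127621,
  R12 p127637, R13 p127577, R14 p127628, R9′ p127613; helpers p127975, p128062);
* rung 2′ `fibrewiseStokesGeneration_transport` (rule (2) on the interval) — p128276 (R15 p127806);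
* rung 6 `fibrewiseStokesGeneration_dlogSwap` (dlog transposition on the square, Baker-free) — p128879 (W1 p128774,
  W2 p128593); W3 `stub_kernelAlgKInterval` p128269;
* rung 2″ `fibrewiseStokesGeneration_isotopy2` (rule (2) on the square, face-preserving isotopies) — p129658 (T1 p129379);
* rung 7 `fibrewiseStokesGeneration_subintervalDlog` (rule (2) between different sub-intervals, dlog layer) — p129814
  (R16 p129687);
* the S2 class `FibStokesDecomposable` (Defs p128676), dictionary p129321, closure algebra p129111 p129271 p129391
  p129413 p129517 p129608 p129778; kernel theorems p126386.
-/


/-! ## Rung 8: the complete genus-0 layer of dimension one (lead c5)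

The dimension-one GRAND ASSEMBLY of S2 in its strict economy. A closed-interval representation whose integrand is a
MIXED form `g₀ + Σᵢ cᵢ pᵢ′/pᵢ + Σₖ dₖ·Im(Pₖ′/Pₖ)` — an exact part `g₀ = G₀′` with `ℚ`-semialgebraic `C¹` primitive,
positive polynomials `pᵢ` and zero-free complex polynomial loops `Pₖ = Aₖ + iBₖ` with real algebraic coefficients,
algebraic coefficients `cᵢ, dₖ` — and value `0` is fibrewise-Stokes decomposable; by pointwise real partial
fractions over `ℚ̄ ∩ ℝ` this covers EVERY rational integrand `P/Q`, `P, Q ∈ (ℚ̄ ∩ ℝ)[X]`, `Q` zero-free on `[0,1]`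
(the S2-economy twin of the kernel form `stub_kernelAlgKInterval`, p128269). Route: the value is
`r + Σᵢ cᵢ log εᵢ + Σₖ dₖ Θₖ` with `r = G₀(1) − G₀(0)` algebraic, `εᵢ = pᵢ(1)/pᵢ(0)` and `e^{iΘₖ}` algebraic
(`stub_loopAngleExp`); mixed Baker in decomposition form (`stub_rungMixedBaker`, R8, p126025) kills `r` and splits
`(c, d)` into real-algebraic combinations of integer vectors `(M_q, N_q)` with `Π εᵢ^{M_q i} = 1` and
`Σₖ N_q k Θₖ = 0` EXACTLY; hence the exact+dlog part has value `0` by itself (rung 2, p126066) and the angular part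
is `Σ_q c_q·Im(P_q′/P_q)` for the product loops `P_q = Πₖ Pₖ^{±N_q k}` (`stub_loopZPow`) of total angle `0`
(rung 4, p128548); the closure algebra (p129391, p129517, p129271) assembles. Stubs W1–W6 below; assemblies
`fibStokesDecomposable_angularMulti`, `fibStokesDecomposable_dimOneMixed`, `fibStokesDecomposable_ratAlgK` (lead).
Plus ONE structural lemma of the converse programme (summit ⇒ S2): S2's economy absorbs the cubified rule (3)
(`stub_clampedNewtonLeibniz`: the Newton–Leibniz relator over a band with semialgebraic ends inside the cube and a
bounded primitive is ONE fibrewise Stokes element, with the CLAMPED primitive).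
-/

/-! LANDED (lead c5, wave 1 — all six rung-8 stubs, imported above): `stub_loopAngleExp` (W1) p131006
`…StubLoopAngleExp.lean`; `stub_loopZPow` (W2) p130818 `…StubLoopZPow.lean`; `stub_rawPartialFractions` (W3) p130730
`…StubRawPartialFractions.lean`; `stub_quadPoleReduction` (W4) p130967 `…StubQuadPoleReduction.lean`; `stub_mixedValue` (W5)
p130742 `…StubMixedValue.lean`; `stub_clampedNewtonLeibniz` (W6) p131084 `…StubClampedNewtonLeibniz.lean`. -/

/-! ## Rung 8 assemblies (lead c5): LANDED — imported from the tree
* part I `fibStokesDecomposable_angularMulti` — p131299 `…FibrewiseRungDimOneAngular.lean` (+ `exists_cubeRep_one`,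
  `value_cubeRep_one_eq_intervalIntegral`, `continuousOn_angular`, `isSemialgebraicFunOn_angular`, `isSemialgebraicFunOn_logDeriv`);
* part II `fibStokesDecomposable_dimOneMixed` — p131395 `…FibrewiseRungDimOneMixed.lean`;
* part III `exists_mixedForm_ratAlgK`, `fibStokesDecomposable_ratAlgK`, kernel form `of_mem_relations_ratAlgK` — p131637
  `…FibrewiseRungDimOneRational.lean`.
-/

/-! ## Rung 9: the angular transposition sector and the separated-variables layer (lead c5, wave 2)

TRANSPOSITION `ω_P(x₀) − ω_P(x₁)` of the angular derivative `ω_P = Im(P′/P)` of a zero-free polynomial loop — the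
angular twin of rung 6's dlog transposition, equally Baker-free. Closed-form transport of `arg W`,
`W = (1 − y) Q(x₁) + y P(x₀)` (zero-free when `Re P, Re Q > 0`): the `y`-component of `d arg W` is
`b = Im(P(x₀) conj Q(x₁))/|W|²`, and with `G^y = γ (y ω_P(x₀) + (1 − y) ω_Q(x₁) − (a₀ + a₁))` (faces vanish) the relator is
three elements (`stub_angTransport`) plus four leftovers `b|_{x₀=c}`, `b|_{x₁=c}`, each the angular derivative of a
`y`-SEGMENT LOOP between two right-half-plane points depending semialgebraically on a silent parameter, certified by the
half-angle kernel `K = T/(1 + T² w²)`, `M = w T′/(1 + w² T²)` (`stub_paramHalfAngleCertificate`, two elements each, explicit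
face `κ(T(1)) − κ(T(0))`, `κ(τ) = τ/(1 + τ² w²)`); for the SELF-transposition `Q = P` the eight faces telescope to zero:
eleven elements on `[0,1]⁴`, no Baker. General zero-free loops factor over `ℚ̄` into linear loops rotated into the right
half-plane (`stub_loopLinearFactors`). With coordinate re-embedding (`stub_placeCoords`), the value of a one-coordinate
integrand on the `N`-cube (`stub_valueOneCoord`), the exact transposition (`stub_exactSwap`) and rung 6 this yields THEOREM D
(lead): S2 for every SEPARATED-VARIABLES rational integrand `Σⱼ γⱼ Rⱼ(x_{aⱼ})` on `[0,1]^N` of value `0`.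
-/

/-! ## Rung 9e + rung 10 stubs (lead c5, wave 3): ℤ-combinations of cube representations; the semialgebraic Baker layer

`stub_zsmulSumCube` merges a `ℤ`-combination of closed-cube representations of one dimension into ONE representation (integrand
additivity), for the kernel-conjecture packaging of THEOREM D. Rung 10 generalises the dimension-one Baker layer from POLYNOMIAL
to SEMIALGEBRAIC data (logarithmic differentials `dG₀ + Σ cᵢ dlog fᵢ + Σ dₖ d arg(Aₖ + iBₖ)` with `ℚ`-semialgebraic `C¹` functions —
everything below genus one): the two-element dlog certificate (R2) and the half-angle machinery are differential-algebraic and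
carry over; the stubs below supply the semialgebraic normalised product (X1), the value formula (X2), the algebraicity of
`e^{i·total angle}` (X3), the partition (X4) and the arctan FTC (X6) for semialgebraic loops.
-/

/-! LANDED (lead c5, waves 2–3): V1 `stub_angTransport` p132367; V2 `stub_paramHalfAngleCertificate` p131768; V3
`stub_loopLinearFactors` p131849; V9 `stub_zsmulSumCube` p132269; X1 `stub_saDlogProd` p132297; X2 `stub_saDlogValue` p132241;
X3 `stub_saLoopAngleExp` p132290; X4 `stub_saPartition` p132254; X6 `stub_saArctanFTC` p132092 (imported above). -/

/-! ## Rung 9 assemblies (lead c5) — registered, to land as `…FibrewiseRungAngSwap.lean` / `…FibrewiseRungSeparated.lean` -/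

/-! LANDED (lead c5, waves 3–5 + assemblies, imported above): `stub_saClampedAngularCertificate` p132762 `…StubSaClampedAngularCertificate.lean`; `stub_saMixedValue` p132668 `…StubSaMixedValue.lean`; `stub_saLoopZPow` p132777 `…StubSaLoopZPow.lean`; `stub_saSwapTransport` p132805 `…StubSaSwapTransport.lean`; `fibStokesDecomposable_angSwapPos` p132692 `…FibrewiseRungAngSwap.lean`; `fibStokesDecomposable_separatedRat` p132794 `…FibrewiseRungSeparated.lean`; `fibStokesDecomposable_saDlogSector` p132724 `…FibrewiseRungSaDlogSector.lean`; `fibStokesDecomposable_saAngularSector` p132864 `…FibrewiseRungSaAngularSector.lean`; `fibStokesDecomposable_saDlogSwap` p133166 `…FibrewiseRungSaDlogSwap.lean`; `fibStokesDecomposable_saAngularMulti` p133954 `…FibrewiseRungSaMixed.lean`; `fibStokesDecomposable_saDimOneMixed` p133954 `…FibrewiseRungSaMixed.lean`; `stub_clampedLoopPiece` p133518 `…StubClampedLoopPiece.lean`; `stub_kinkedAngTransport` p134042 `…StubKinkedAngTransport.lean`; `stub_boxToCube` p133816 `…StubBoxToCube.lean`. -/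

/-! ## Wave 5 stubs (lead c5): the angular transposition for SEMIALGEBRAIC loops (towards THEOREM D′) -/

/-! ## Rungs 11–14 (lead c5): the scaling certificate; permutations, reflections, reparametrisations, subdivisions — all LANDED -/

/-! LANDED (lead c5, rungs 9f, 10e, D′, 11–14, imported above): `fibStokesDecomposable_subdivisionCore`, `fibStokesDecomposable_sub_subdivision` p135789 `…FibrewiseRungSubdivision.lean`; `fibStokesDecomposable_saAngSwap` p135148 `…FibrewiseRungSaAngSwap.lean`; `fibStokesDecomposable_saSeparated` p135353 `…FibrewiseRungSaSeparated.lean`; `of_mem_relations_separatedRat_box` p134175 `…FibrewiseRungSeparatedBox.lean`; `fibStokesDecomposable_scalingCore` p135184 `…FibrewiseRungScaling.lean`; `fibStokesDecomposable_atomSwap` p135352 `…FibrewiseRungScalingSwaps.lean`; `fibStokesDecomposable_atomRefl` p135352 `…FibrewiseRungScalingSwaps.lean`; `fibStokesDecomposable_separated_of_dimOne` p135352 `…FibrewiseRungScalingSwaps.lean`; `fibStokesDecomposable_sub_comp_perm` p135553 `…FibrewiseRungPermutation.lean`; `fibStokesDecomposable_sub_comp_reflect` p135553 `…FibrewiseRungPermutation.lean`;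 `fibStokesDecomposable_reparamCore` p135554 `…FibrewiseRungReparam.lean`; `fibStokesDecomposable_sub_reparam` p135554 `…FibrewiseRungReparam.lean`. -/

/-! LANDED (lead c5, wave 2): `stub_placeCoords` (V6) p131599 `…StubPlaceCoords.lean`; `stub_valueOneCoord` (V7) p131634
`…StubValueOneCoord.lean`; `stub_exactSwap` (V8) p131617 `…StubExactSwap.lean` (imported above). -/

/-! ## Rungs 15–17 (lead c6): rule (2) for general face-preserving `C²` self-maps of the cube in all dimensions
(the suspension / null-Lagrangian certificate); diagonal reparametrisations and the polylogarithm duplication relators;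
the genus-one entry point (elliptic translation). Registered stubs of wave 1 (K1–K5, P1, E1, T1).

RUNG 15. For a `ℚ`-semialgebraic `C²` map `Φ : U → ℝ^N` (`U ⊇ [0,1]^N` open) mapping the closed cube into itself and
each face `{x_j = c}` (`c ∈ {0,1}`) into itself, and a `ℚ`-semialgebraic `C¹` integrand `h` on `U`, the rule-(2) relator
`h − (h∘Φ)·det DΦ` is fibrewise-Stokes decomposable with `N + 1` elements on `[0,1]^{N+1}`: the SUSPENSION
`F(x,t) = ((1−t)x + tΦ(x), t)` of the straight-line homotopy and the field `G = h(y)·e_t` have Piola field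
`W = adj(DF)·(G∘F)` (`Literature.Analysis.Calculus.piolaField`) with `W_t = (h∘Φ_t)·det DΦ_t`,
`W_j = −(h∘Φ_t)·(adj(DΦ_t)(Φ − id))_j`, and the tree's null-Lagrangian identity
(`Literature.Analysis.Calculus.sum_fderiv_piolaField`: Jacobi's formula + Piola's identity) says `div W = (div G)∘F · det DF = 0`;
the S2 elements are `G_j = W_j` along the coordinate `j` itself, `D_j = ∂_j W_j` (sum zero), the `t`-faces give
`(h∘Φ)det DΦ − h` and the `x_j`-faces vanish (face preservation ⇒ row `j` of `DΦ_t` is a multiple of `e_j` on `{x_j = c}` and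
`(Φ − id)_j = 0` there ⇒ `(adj(DΦ_t)(Φ − id))_j = 0`). No transcendence input, no value hypothesis, `Φ` need not be injective.
-/

/-! LANDED: `stub_adjugate_blockTriangular` (wave 1, lead c6) — imported from the tree. -/

/-! LANDED: `stub_adjugate_mulVec_face` (wave 1, lead c6) — imported from the tree. -/

/-! LANDED: `stub_jacobianMatrix_suspension` — p138140, `Theorems/UnfoldedStokesStokesGenerationStubJacobianMatrixSuspension.lean` (imported above; exact registered signature). -/

/-! LANDED: `stub_suspension_regularity` — p138114, `Theorems/UnfoldedStokesStokesGenerationStubSuspensionRegularity.lean` (imported above; exact registered signature). -/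

/-! LANDED: `stub_suspension_semialgebraic` — p138146, `Theorems/UnfoldedStokesStokesGenerationStubSuspensionSemialgebraic.lean` (imported above; exact registered signature). -/

/-! RUNG 16 (P1): diagonal reparametrisations `x ↦ (ψ_a(x_a))_a` — iterate rung 13 (`fibStokesDecomposable_sub_reparam`) one
coordinate at a time (cocycle `R_{ΨΨ'}(f) = R_{Ψ'}(f) + R_Ψ((f∘Ψ')J_{Ψ'})`, closure under sums); corollary: the polylogarithm
DUPLICATION relators — `Li_n(z) = ∫_{[0,1]^n} z/(1 − zΠxᵢ)`, and `2^{1−n}Li_n(z²) − Li_n(z) − Li_n(−z)` is, POINTWISE, the relator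
`f − (f∘Ψ)J_Ψ` of the squaring map `Ψ(x) = (xᵢ²)ᵢ` for `f = 2^{1−n}z²/(1 − z²Πxᵢ)` — are decomposable at every algebraic
`z ∈ (−1,1)`, in every weight `n`: the first non-separated weight-`≥ 2` instances of S2 (value-free). -/

/-! LANDED: `stub_diagReparam` — p137940, `Theorems/UnfoldedStokesStokesGenerationStubDiagReparam.lean` (imported above; exact registered signature). -/

/-! LANDED: `stub_polylogDuplication` — p138162, `Theorems/UnfoldedStokesStokesGenerationStubPolylogDuplication.lean` (imported above; exact registered signature). -/

/-! RUNG 17 (E1, T1): the genus-one entry point. On `y² = x³ + a₂x² + a₄x + a₆` the differential `dx/y` is invariant under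
translation by a point `Q = (x₀, y₀)`: with `λ = (y − y₀)/(x − x₀)`, `x₃ = λ² − a₂ − x − x₀`, `y₃ = −(y + λ(x₃ − x))`
(`P ⊕ Q = (x₃, y₃)`) one has `dx₃/dx = y₃/y` along the curve (E1). With the general rule (2) between two different intervals
for semialgebraic `C¹` data (T1, affine renormalisation of rung 2′) the ELLIPTIC TRANSLATION RELATOR
`∫_{x(P₁)}^{x(P₂)} dx/y − ∫_{x(P₁⊕Q)}^{x(P₂⊕Q)} dx/y` (arcs free of branch points) is decomposable — lead assembly, wave 2. -/

/-! LANDED: `stub_ellipticTranslationDeriv` (wave 1, lead c6) — imported from the tree. -/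

/-! LANDED: `stub_intervalTransport` — p138154, `Theorems/UnfoldedStokesStokesGenerationStubIntervalTransport.lean` (imported above; exact registered signature). -/


/-! ## Rung 18 (lead c6, wave 2): LANDEN'S IDENTITY `Li₂(a) + Li₂(−a/(1−a)) + ½log²(1−a) = 0` is fibrewise-Stokes
decomposable at every real algebraic `a < 1` — the first weight-2 identity of the line that is NOT a pointwise cube move
(it mixes the arguments `a` and `−a/(1−a)`), certified TRANSCENDENCE-FREE by the homotopy `a ↦ au` in a third cube
coordinate `u`: with `T₁ = au/(1−aust)` (`Li₂(au)`), `T₂ = −au/(1−au+aust)` (`Li₂(−au/(1−au))`),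
`T₃ = ½a²u²/((1−aus)(1−aut))` (`½log²(1−au)`) and `F = T₁ + T₂ + T₃` (`F|_{u=0} = 0`, `F|_{u=1}` = the Landen integrand), one
element along `u` (primitive `F`) trades the Landen integrand for `∂_uF`; elements along `t` (primitives `−at/(1−aust)`,
`at/((1−au)(1−au+aust))`) and along `s` (primitive `−a²us/((1−aus)(1−aut))`) integrate `∂_uT₁`, `∂_uT₂` and the symmetrised
`∂_uT₃` out in closed RATIONAL form; what is left is `A + R₁ + R₂ + R₃` with `A` antisymmetric under `s ↔ t`, `R₃(t,u) − R₃(s,u)`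
antisymmetric, and `R₁ + R₂ + R₃ = (a/(1−au))·(g(s) − g(1−s))`, `g(s) = 1/(1−aus)` — all decomposable by rung 12 (permutations
and reflections). Stubs L1a–L1c are the three two-element certificates (one per `Tᵢ`); the lead assembles. -/

/-! LANDED: `stub_landenPartOne` — p138602, `Theorems/UnfoldedStokesStokesGenerationStubLandenPartOne.lean` (imported above; exact registered signature). -/

/-! LANDED: `stub_landenPartTwo` — p139007, `Theorems/UnfoldedStokesStokesGenerationStubLandenPartTwo.lean` (imported above; exact registered signature). -/

/-! LANDED: `stub_landenPartThree` — p138972, `Theorems/UnfoldedStokesStokesGenerationStubLandenPartThree.lean` (imported above; exact registered signature). -/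


/-! LANDED: `stub_landenLeftovers` — p138928, `Theorems/UnfoldedStokesStokesGenerationStubLandenLeftovers.lean` (imported above; exact registered signature). -/

/-! ## Rung 19 (lead c6, wave 3): the FIVE-TERM RELATION of the dilogarithm (Hill's form
`Li₂(ab) = Li₂(a) + Li₂(b) + Li₂(−a(1−b)/(1−a)) + Li₂(−b(1−a)/(1−b)) + ½log²((1−a)/(1−b))`, `|a|, |b| < 1`) is fibrewise-Stokes
decomposable at all real algebraic arguments — by the homotopy `b ↦ bv` down to Landen's identity (rung 18): the generic
polylogarithm-argument homotopy (G1) and the log-product homotopy (G2) trade `F|_{v=1} − F|_{v=0}` for one-dimensional integrands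
with the silent parameter `v`, which are killed by two PARAMETRIC three-term dlog certificates (HA, HB: rung 2's homotopy
`E = 1 + (P − 1)y` for the loops `P_A = (1 + s·a(1−bv)/(1−a))(1−as)/(1−abvs)`, `P_B = (1 + s·bv(1−a)/(1−bv))(1−bvs)/(1−abvs)`,
the second divided by `bv`) with RATIONAL coefficient functions `∓b/(1−bv)` — transcendence-free, value-free. -/

/-! LANDED: `stub_polylogArgHomotopy` — p139295, `Theorems/UnfoldedStokesStokesGenerationStubPolylogArgHomotopy.lean` (imported above; exact registered signature). -/

/-! LANDED: `stub_logProductHomotopy` — p139351, `Theorems/UnfoldedStokesStokesGenerationStubLogProductHomotopy.lean` (imported above; exact registered signature). -/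

/-! LANDED: `stub_hillRelationA` — p139317, `Theorems/UnfoldedStokesStokesGenerationStubHillRelationA.lean` (imported above; exact registered signature). -/

/-! LANDED: `stub_hillRelationB` — p139997, `Theorems/UnfoldedStokesStokesGenerationStubHillRelationB.lean` (imported above; exact registered signature). -/

/-! LANDED: `fibStokesDecomposable_fiveTerm` — p140464, `Theorems/UnfoldedStokesStokesGenerationFibrewiseRungFiveTerm.lean` (imported above; exact registered signature). -/


/-! ## Rung 20 (lead c6, wave 4): Euler's reflection relator `Li₂(x) + Li₂(1−x) + log x·log(1−x)` is CONSTANT modulo Dec along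
algebraic `x ∈ (0,1)` — the homotopy `x(v) = x₁ + (x₂ − x₁)v` (G1 twice + the log-pair homotopy G2′; the leftover is one
transposition). The anchor value `π²/6` is NOT claimed (it needs `π` to enter S2's economy: frontier). -/

/-! LANDED: `stub_logPairHomotopy` — p140327, `Theorems/UnfoldedStokesStokesGenerationStubLogPairHomotopy.lean` (imported above; exact registered signature). -/

/-! LANDED: `fibStokesDecomposable_eulerReflection_sub` — p140613, `Theorems/UnfoldedStokesStokesGenerationFibrewiseRungEulerReflection.lean` (imported above; exact registered signature). -/


/-! ## Rungs 21–22 (lead c6, wave 5): two geometric tools towards cubification (frontier C4) — subdivision of the cube at a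
VARIABLE height `x_a = φ(x̂)` (domain additivity along a semialgebraic graph, rescaled back to the cube), and rule (2) for
fibrewise reparametrisations with KINKS (piecewise `C¹` along the fibre: the first use of S2's kink-set clause `K`). -/

/-- STUB (W21, wave 5, lead c6) **subdivision at a variable height is absorbed (core form with an idle coordinate).** As rung 14
(`fibStokesDecomposable_subdivisionCore`, cut at the constant height `t₀`) with `t₀` replaced by a `ℚ`-semialgebraic continuous
height function `φ` of the OTHER coordinates (independent of `x_a` and of the idle `x_b`, values in `[0,1]`): the relator
`f(x) − φ(x)·f(x[a ↦ φ(x)x_a]) − (1 − φ(x))·f(x[a ↦ φ(x) + (1 − φ(x))x_a])` — additivity along the graph `x_a = φ` followed by the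
two triangular rescalings — is fibrewise-Stokes decomposable with TWO elements (homotopy of the cutting height
`τ = φ + (1 − φ)x_b` in the idle coordinate and the Euler identity of rung 14, in which the height is a mere parameter).
[cite: KontsevichZagier2001, §1.2 rules (1), (2), (3)] -/
theorem stub_subdivisionVar {N : ℕ} (a b : Fin N) (hab : a ≠ b) (φ f fₐ : (Fin N → ℝ) → ℝ)
    (hφ : IsSemialgebraicFunOn ℚ (Set.pi Set.univ (fun _ : Fin N => Set.Icc (0:ℝ) 1)) φ)
    (hφc : ContinuousOn φ (Set.pi Set.univ (fun _ : Fin N => Set.Icc (0:ℝ) 1)))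
    (hφa : ∀ x s, φ (Function.update x a s) = φ x) (hφb : ∀ x s, φ (Function.update x b s) = φ x)
    (hφI : ∀ x ∈ Set.pi Set.univ (fun _ : Fin N => Set.Icc (0:ℝ) 1), φ x ∈ Set.Icc (0:ℝ) 1)
    (hf : IsSemialgebraicFunOn ℚ (Set.pi Set.univ (fun _ : Fin N => Set.Icc (0:ℝ) 1)) f)
    (hfₐ : IsSemialgebraicFunOn ℚ (Set.pi Set.univ (fun _ : Fin N => Set.Icc (0:ℝ) 1)) fₐ)
    (hfc : ContinuousOn f (Set.pi Set.univ (fun _ : Fin N => Set.Icc (0:ℝ) 1)))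
    (hfₐc : ContinuousOn fₐ (Set.pi Set.univ (fun _ : Fin N => Set.Icc (0:ℝ) 1)))
    (hfb : ∀ x s, f (Function.update x b s) = f x)
    (hfd : ∀ x ∈ Set.pi Set.univ (fun _ : Fin N => Set.Icc (0:ℝ) 1), x a ∈ Set.Ioo (0:ℝ) 1 →
      HasDerivAt (fun s => f (Function.update x a s)) (fₐ x) (x a)) :
    FibStokesDecomposable N (fun x => f x - φ x * f (Function.update x a (φ x * x a)) -
      (1 - φ x) * f (Function.update x a (φ x + (1 - φ x) * x a))) := by
  sorry

/-- STUB (W13k, wave 5, lead c6) **rule (2) for a fibrewise reparametrisation with finitely many kinks (core form with an idle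
coordinate).** As rung 13 (`fibStokesDecomposable_reparamCore`) but the new coordinate `ψ` is only PIECEWISE `C¹` along `a`:
continuous on the closed cube, differentiable along `a` with derivative `ψₐ` at every interior point whose height `x_a` avoids a
finite set `T` of algebraic kink heights, `ψₐ` `ℚ`-semialgebraic and BOUNDED (not necessarily continuous). The same two
elements work, now with the kink set `K = {x | x_a ∈ T}` (finite `a`-fibres) for the element along `a`, and bounded
semialgebraic (hence integrable) carried integrands — the first use of the kink clause of `FibStokesDecomposable`.
[cite: KontsevichZagier2001, §1.2 rules (2), (3)] -/
theorem stub_reparamKinked {N : ℕ} (a b : Fin N) (hab : a ≠ b) (T : Finset ℝ) (hT : ∀ t ∈ T, IsAlgebraic ℚ t)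
    (f fₐ ψ ψₐ : (Fin N → ℝ) → ℝ)
    (hf : IsSemialgebraicFunOn ℚ (Set.pi Set.univ (fun _ : Fin N => Set.Icc (0:ℝ) 1)) f)
    (hfₐ : IsSemialgebraicFunOn ℚ (Set.pi Set.univ (fun _ : Fin N => Set.Icc (0:ℝ) 1)) fₐ)
    (hψ : IsSemialgebraicFunOn ℚ (Set.pi Set.univ (fun _ : Fin N => Set.Icc (0:ℝ) 1)) ψ)
    (hψₐ : IsSemialgebraicFunOn ℚ (Set.pi Set.univ (fun _ : Fin N => Set.Icc (0:ℝ) 1)) ψₐ)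
    (hfc : ContinuousOn f (Set.pi Set.univ (fun _ : Fin N => Set.Icc (0:ℝ) 1)))
    (hfₐc : ContinuousOn fₐ (Set.pi Set.univ (fun _ : Fin N => Set.Icc (0:ℝ) 1)))
    (hψc : ContinuousOn ψ (Set.pi Set.univ (fun _ : Fin N => Set.Icc (0:ℝ) 1)))
    (hψₐB : ∃ B : ℝ, ∀ x ∈ Set.pi Set.univ (fun _ : Fin N => Set.Icc (0:ℝ) 1), |ψₐ x| ≤ B)
    (hfb : ∀ x s, f (Function.update x b s) = f x)
    (hψb : ∀ x s, ψ (Function.update x b s) = ψ x) (hψₐb : ∀ x s, ψₐ (Function.update x b s) = ψₐ x)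
    (hfd : ∀ x ∈ Set.pi Set.univ (fun _ : Fin N => Set.Icc (0:ℝ) 1), x a ∈ Set.Ioo (0:ℝ) 1 →
      HasDerivAt (fun s => f (Function.update x a s)) (fₐ x) (x a))
    (hψd : ∀ x ∈ Set.pi Set.univ (fun _ : Fin N => Set.Icc (0:ℝ) 1), x a ∈ Set.Ioo (0:ℝ) 1 → x a ∉ T →
      HasDerivAt (fun s => ψ (Function.update x a s)) (ψₐ x) (x a))
    (hψ0 : ∀ x ∈ Set.pi Set.univ (fun _ : Fin N => Set.Icc (0:ℝ) 1), x a = 0 → ψ x = 0)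
    (hψ1 : ∀ x ∈ Set.pi Set.univ (fun _ : Fin N => Set.Icc (0:ℝ) 1), x a = 1 → ψ x = 1)
    (hψIoo : ∀ x ∈ Set.pi Set.univ (fun _ : Fin N => Set.Icc (0:ℝ) 1), x a ∈ Set.Ioo (0:ℝ) 1 →
      ψ x ∈ Set.Ioo (0:ℝ) 1) :
    FibStokesDecomposable N (fun x => f x - f (Function.update x a (ψ x)) * ψₐ x) := by
  sorry


/-! ## Rung 23 (lead c6, wave 5): the genus-one ISOGENY layer — the 2-isogeny relator on incomplete arcs and Gauss's
arithmetic–geometric-mean step (Landen's transformation of the complete integral) are fibrewise-Stokes decomposable.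
The strategist's census (T8) names Landen/Gauss as THE order-2 test of "find the correspondence": here the correspondence is
the 2-isogeny `(x,y) ↦ (x + a + b/x, y(x² − b)/x²)` from `y² = x(x² + ax + b)` onto `Y² = X(X² − 2aX + a² − 4b)`, along which
`dX/Y = ±dx/y`; both relators are instances of rule (2) in dimension one for semialgebraic `C¹` data (`stub_intervalTransport`,
rungs 12–14), transcendence-free and value-free. -/

/-- STUB (I1, wave 5, lead c6) **the 2-isogeny relator.** On `E : y² = x(x² + ax + b)` (real algebraic `a, b`) let
`φ : E → E′ : Y² = X(X² − 2aX + a² − 4b)` be the 2-isogeny with kernel `(0,0)`, `X = ψ(x) = x + a + b/x`,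
`Y = y·(x² − b)/x²`, so that `φ^*(dX/Y) = dx/y` where `x² > b`. For an arc `x ∈ [α, β]` (algebraic ends) on which
`x(x² + ax + b) > 0` and `x² > b` (so `ψ` is increasing and neither arc meets a branch point), the difference of the
cube-normalised integrands of `∫_α^β dx/y` and `∫_{ψ(α)}^{ψ(β)} dX/Y` (positive square roots) is fibrewise-Stokes decomposable:
`stub_intervalTransport` with `φ = ψ`, `φ′ = (x² − b)/x²`, and the pointwise identity `Y(ψ(x))² = x(x²+ax+b)(x²−b)²/x⁴`.
[cite: SilvermanAEC2009, III.4.5] -/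
theorem stub_isogenyTwoRelator (a b α β : ℝ) (ha : IsAlgebraic ℚ a) (hb : IsAlgebraic ℚ b)
    (hα : IsAlgebraic ℚ α) (hβ : IsAlgebraic ℚ β) (hαβ : α < β)
    (hf : ∀ u ∈ Set.Icc α β, 0 < u * (u ^ 2 + a * u + b)) (hmono : ∀ u ∈ Set.Icc α β, b < u ^ 2)
    (y Y ψ : ℝ → ℝ) (hy : y = fun u => Real.sqrt (u * (u ^ 2 + a * u + b)))
    (hY : Y = fun U => Real.sqrt (U * (U ^ 2 - 2 * a * U + (a ^ 2 - 4 * b))))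
    (hψ : ψ = fun u => u + a + b / u) :
    FibStokesDecomposable 1 (fun s => (β - α) / y (α + (β - α) * s 0) -
      (ψ β - ψ α) / Y (ψ α + (ψ β - ψ α) * s 0)) := by
  sorry

/-- STUB (A1, wave 5, lead c6) **Gauss's AGM step (Landen's transformation of the complete integral) is decomposable.**
For real algebraic `a, b > 0` let `I(a,b) = ∫₀^∞ dt/√((t²+a²)(t²+b²))`, presented on the cube by `t = s/(1−s)`:
`P_{a,b}(s) = 1/√((s² + a²(1−s)²)(s² + b²(1−s)²))` (smooth and bounded on `[0,1]`). Gauss: `I(a,b) = I((a+b)/2, √(ab))`.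
The relator `P_{a,b} − P_{(a+b)/2, √(ab)}` is fibrewise-Stokes decomposable, by the chain (`B = √(ab)`, algebraic):
(i) Newman's substitution `x = ½(t − ab/t)` gives POINTWISE `Q(s) = 2·P_{a,b}(φ(s))·φ′(s)` for the full-line presentation
`Q(s) = k(Bc(s))·B·c′(s) = 2B/√((ab s² + a²(1−s)²)(ab s² + b²(1−s)²))` of `∫_ℝ dx/√((x²+((a+b)/2)²)(x²+ab))`
(`c(s) = (2s−1)/(2s(1−s))`, `φ(s) = Bs/(1 − s + Bs)`), and `(P_{a,b}∘φ)·φ′ − P_{a,b} ∈ Dec` (`stub_intervalTransport` on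
`[0,1]`); (ii) `Q(1−s) = Q(s)`, so `Q − Q(½ + s/2) ∈ Dec` (subdivision at `½`, rung 14, and a reflection, rung 12);
(iii) `½Q(½ + u/2) = P_{A,B}(χ(u))·χ′(u)` pointwise with `χ(u) = 2Bu/(1 − u² + 2Bu)` (the half line `x = 2Bu/(1−u²)` against
`x = s/(1−s)`), and `(P_{A,B}∘χ)·χ′ − P_{A,B} ∈ Dec` (`stub_intervalTransport`). [cite: BorweinBorwein1987, Thm 1.1] -/
theorem stub_agmRelator (a b : ℝ) (ha : IsAlgebraic ℚ a) (hb : IsAlgebraic ℚ b) (ha0 : 0 < a) (hb0 : 0 < b) :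
    FibStokesDecomposable 1 (fun z =>
      1 / Real.sqrt ((z 0 ^ 2 + a ^ 2 * (1 - z 0) ^ 2) * (z 0 ^ 2 + b ^ 2 * (1 - z 0) ^ 2)) -
        1 / Real.sqrt ((z 0 ^ 2 + ((a + b) / 2) ^ 2 * (1 - z 0) ^ 2) * (z 0 ^ 2 + a * b * (1 - z 0) ^ 2))) := by
  sorry

/-! ## Rung 24 (lead c6, wave 5): generic homotopy tools of weight three — the polylogarithm-argument homotopy for `Li₃`
and the product homotopies `log × Li₂` and `log × log × log` (one element along the homotopy parameter and one closed-form
element per factor). With rung 25 (Landen's identity with a PARAMETER) they assemble rung 26: the trilogarithm. -/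

/-- STUB (G3, wave 5, lead c6) **the polylogarithm-argument homotopy in weight three**: for a semialgebraic `C¹` path of
arguments `w(v) < 1`, on `[0,1]⁴` (`s = x 0`, `t = x 1`, `u = x 2`, `v = x 3`; `T_w(s,t,u) = w/(1 − wstu)` is the cube
integrand of `Li₃(w)`): `T_{w(1)} − T_{w(0)} ≡ w′(v)/(1 − w(v)st)` (`= (w′/w)·`the `Li₂(w)` integrand: `dLi₃(w) = Li₂(w)dw/w`) —
two elements, `E_v[G = w(v)/(1 − w(v)stu)]` and `E_u[G = −w′(v)u/(1 − w(v)stu)]`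
(`∂_v[w/(1−wstu)] = w′/(1−wstu)² = ∂_u[w′u/(1−wstu)]`). The weight-three twin of `stub_polylogArgHomotopy`.
[cite: Zagier2007Dilogarithm, §I.2] -/
theorem stub_polylogArgHomotopy3 (w w' : ℝ → ℝ)
    (hw : IsSemialgebraicFunOn ℚ (Set.pi Set.univ (fun _ : Fin 1 => Set.Icc (0:ℝ) 1)) (fun z => w (z 0)))
    (hw' : IsSemialgebraicFunOn ℚ (Set.pi Set.univ (fun _ : Fin 1 => Set.Icc (0:ℝ) 1)) (fun z => w' (z 0)))
    (hwc : ContinuousOn w (Set.Icc (0:ℝ) 1)) (hw'c : ContinuousOn w' (Set.Icc (0:ℝ) 1))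
    (hwd : ∀ v ∈ Set.Ioo (0:ℝ) 1, HasDerivAt w (w' v) v) (hw1 : ∀ v ∈ Set.Icc (0:ℝ) 1, w v < 1) :
    FibStokesDecomposable 4 (fun x => w' (x 3) / (1 - w (x 3) * x 0 * x 1) -
      (w 1 / (1 - w 1 * x 0 * x 1 * x 2) - w 0 / (1 - w 0 * x 0 * x 1 * x 2))) := by
  sorry

/-- STUB (PH2, wave 5, lead c6) **the `log × Li₂` product homotopy**: a one-dimensional parametric integrand `ℓ(u,v)` (e.g.
`∫ℓ du = log(1 − x(v))`) with `v`-derivative `ℓᵥ` admitting a closed-form `u`-primitive `μ` (`∂_u μ = ℓᵥ`, `μ(0,v) = 0`), times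
a two-dimensional parametric integrand `T(s,t,v)` (e.g. the `Li₂(x(v))` integrand) with `v`-derivative `Tᵥ` admitting a
closed-form `t`-primitive `Θ` (`∂_t Θ = Tᵥ`, `Θ(s,0,v) = 0`). On `[0,1]⁴` (`s = x 0`, `t = x 1`, `u = x 2`, `v = x 3`):
`ℓ(u,1)T(s,t,1) − ℓ(u,0)T(s,t,0) ≡ μ(1,v)T(s,t,v) + ℓ(u,v)Θ(s,1,v)` — three elements, `E_v[G = ℓT]`, `E_u[G = −μT]`,
`E_t[G = −ℓΘ]`. [folklore] -/
theorem stub_logPolylogProductHomotopy (ℓ ℓᵥ μ : ℝ → ℝ → ℝ) (T Tᵥ Θ : ℝ → ℝ → ℝ → ℝ)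
    (hℓ : IsSemialgebraicFunOn ℚ (Set.pi Set.univ (fun _ : Fin 2 => Set.Icc (0:ℝ) 1)) (fun z => ℓ (z 0) (z 1)))
    (hℓᵥ : IsSemialgebraicFunOn ℚ (Set.pi Set.univ (fun _ : Fin 2 => Set.Icc (0:ℝ) 1)) (fun z => ℓᵥ (z 0) (z 1)))
    (hμ : IsSemialgebraicFunOn ℚ (Set.pi Set.univ (fun _ : Fin 2 => Set.Icc (0:ℝ) 1)) (fun z => μ (z 0) (z 1)))
    (hT : IsSemialgebraicFunOn ℚ (Set.pi Set.univ (fun _ : Fin 3 => Set.Icc (0:ℝ) 1)) (fun z => T (z 0) (z 1) (z 2)))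
    (hTᵥ : IsSemialgebraicFunOn ℚ (Set.pi Set.univ (fun _ : Fin 3 => Set.Icc (0:ℝ) 1)) (fun z => Tᵥ (z 0) (z 1) (z 2)))
    (hΘ : IsSemialgebraicFunOn ℚ (Set.pi Set.univ (fun _ : Fin 3 => Set.Icc (0:ℝ) 1)) (fun z => Θ (z 0) (z 1) (z 2)))
    (hℓc : ContinuousOn (fun z : Fin 2 → ℝ => ℓ (z 0) (z 1)) (Set.pi Set.univ (fun _ : Fin 2 => Set.Icc (0:ℝ) 1)))
    (hℓᵥc : ContinuousOn (fun z : Fin 2 → ℝ => ℓᵥ (z 0) (z 1)) (Set.pi Set.univ (fun _ : Fin 2 => Set.Icc (0:ℝ) 1)))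
    (hμc : ContinuousOn (fun z : Fin 2 → ℝ => μ (z 0) (z 1)) (Set.pi Set.univ (fun _ : Fin 2 => Set.Icc (0:ℝ) 1)))
    (hTc : ContinuousOn (fun z : Fin 3 → ℝ => T (z 0) (z 1) (z 2)) (Set.pi Set.univ (fun _ : Fin 3 => Set.Icc (0:ℝ) 1)))
    (hTᵥc : ContinuousOn (fun z : Fin 3 → ℝ => Tᵥ (z 0) (z 1) (z 2)) (Set.pi Set.univ (fun _ : Fin 3 => Set.Icc (0:ℝ) 1)))
    (hΘc : ContinuousOn (fun z : Fin 3 → ℝ => Θ (z 0) (z 1) (z 2)) (Set.pi Set.univ (fun _ : Fin 3 => Set.Icc (0:ℝ) 1)))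
    (hdv : ∀ u ∈ Set.Icc (0:ℝ) 1, ∀ v ∈ Set.Ioo (0:ℝ) 1, HasDerivAt (fun r => ℓ u r) (ℓᵥ u v) v)
    (hdu : ∀ v ∈ Set.Icc (0:ℝ) 1, ∀ u ∈ Set.Ioo (0:ℝ) 1, HasDerivAt (fun r => μ r v) (ℓᵥ u v) u)
    (hμ0 : ∀ v ∈ Set.Icc (0:ℝ) 1, μ 0 v = 0)
    (hTd : ∀ s ∈ Set.Icc (0:ℝ) 1, ∀ t ∈ Set.Icc (0:ℝ) 1, ∀ v ∈ Set.Ioo (0:ℝ) 1,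
      HasDerivAt (fun r => T s t r) (Tᵥ s t v) v)
    (hΘd : ∀ s ∈ Set.Icc (0:ℝ) 1, ∀ v ∈ Set.Icc (0:ℝ) 1, ∀ t ∈ Set.Ioo (0:ℝ) 1,
      HasDerivAt (fun r => Θ s r v) (Tᵥ s t v) t)
    (hΘ0 : ∀ s ∈ Set.Icc (0:ℝ) 1, ∀ v ∈ Set.Icc (0:ℝ) 1, Θ s 0 v = 0) :
    FibStokesDecomposable 4 (fun x => μ 1 (x 3) * T (x 0) (x 1) (x 3) + ℓ (x 2) (x 3) * Θ (x 0) 1 (x 3) -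
      (ℓ (x 2) 1 * T (x 0) (x 1) 1 - ℓ (x 2) 0 * T (x 0) (x 1) 0)) := by
  sorry

/-- STUB (PH3, wave 5, lead c6) **the triple log-product homotopy**: three one-dimensional parametric integrands `ℓᵢ(·,v)`
with `v`-derivatives `ℓᵢᵥ` admitting closed-form primitives `μᵢ` vanishing at `0`, on `[0,1]⁴` (factors along `x 0`, `x 1`,
`x 2`; `v = x 3`): `ℓ₁ℓ₂ℓ₃|_{v=1} − ℓ₁ℓ₂ℓ₃|_{v=0} ≡ μ₁(1,v)ℓ₂ℓ₃ + ℓ₁μ₂(1,v)ℓ₃ + ℓ₁ℓ₂μ₃(1,v)` — four elements,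
`E_v[G = ℓ₁ℓ₂ℓ₃]`, `E_{x0}[G = −μ₁ℓ₂ℓ₃]`, `E_{x1}[G = −ℓ₁μ₂ℓ₃]`, `E_{x2}[G = −ℓ₁ℓ₂μ₃]`. The three-factor twin of
`stub_logPairHomotopy`. [folklore] -/
theorem stub_logTripleProductHomotopy (ℓ₁ ℓ₁ᵥ μ₁ ℓ₂ ℓ₂ᵥ μ₂ ℓ₃ ℓ₃ᵥ μ₃ : ℝ → ℝ → ℝ)
    (hℓ₁ : IsSemialgebraicFunOn ℚ (Set.pi Set.univ (fun _ : Fin 2 => Set.Icc (0:ℝ) 1)) (fun z => ℓ₁ (z 0) (z 1)))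
    (hℓ₁ᵥ : IsSemialgebraicFunOn ℚ (Set.pi Set.univ (fun _ : Fin 2 => Set.Icc (0:ℝ) 1)) (fun z => ℓ₁ᵥ (z 0) (z 1)))
    (hμ₁ : IsSemialgebraicFunOn ℚ (Set.pi Set.univ (fun _ : Fin 2 => Set.Icc (0:ℝ) 1)) (fun z => μ₁ (z 0) (z 1)))
    (hℓ₂ : IsSemialgebraicFunOn ℚ (Set.pi Set.univ (fun _ : Fin 2 => Set.Icc (0:ℝ) 1)) (fun z => ℓ₂ (z 0) (z 1)))
    (hℓ₂ᵥ : IsSemialgebraicFunOn ℚ (Set.pi Set.univ (fun _ : Fin 2 => Set.Icc (0:ℝ) 1)) (fun z => ℓ₂ᵥ (z 0) (z 1)))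
    (hμ₂ : IsSemialgebraicFunOn ℚ (Set.pi Set.univ (fun _ : Fin 2 => Set.Icc (0:ℝ) 1)) (fun z => μ₂ (z 0) (z 1)))
    (hℓ₃ : IsSemialgebraicFunOn ℚ (Set.pi Set.univ (fun _ : Fin 2 => Set.Icc (0:ℝ) 1)) (fun z => ℓ₃ (z 0) (z 1)))
    (hℓ₃ᵥ : IsSemialgebraicFunOn ℚ (Set.pi Set.univ (fun _ : Fin 2 => Set.Icc (0:ℝ) 1)) (fun z => ℓ₃ᵥ (z 0) (z 1)))
    (hμ₃ : IsSemialgebraicFunOn ℚ (Set.pi Set.univ (fun _ : Fin 2 => Set.Icc (0:ℝ) 1)) (fun z => μ₃ (z 0) (z 1)))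
    (hℓ₁c : ContinuousOn (fun z : Fin 2 → ℝ => ℓ₁ (z 0) (z 1)) (Set.pi Set.univ (fun _ : Fin 2 => Set.Icc (0:ℝ) 1)))
    (hℓ₁ᵥc : ContinuousOn (fun z : Fin 2 → ℝ => ℓ₁ᵥ (z 0) (z 1)) (Set.pi Set.univ (fun _ : Fin 2 => Set.Icc (0:ℝ) 1)))
    (hμ₁c : ContinuousOn (fun z : Fin 2 → ℝ => μ₁ (z 0) (z 1)) (Set.pi Set.univ (fun _ : Fin 2 => Set.Icc (0:ℝ) 1)))
    (hℓ₂c : ContinuousOn (fun z : Fin 2 → ℝ => ℓ₂ (z 0) (z 1)) (Set.pi Set.univ (fun _ : Fin 2 => Set.Icc (0:ℝ) 1)))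
    (hℓ₂ᵥc : ContinuousOn (fun z : Fin 2 → ℝ => ℓ₂ᵥ (z 0) (z 1)) (Set.pi Set.univ (fun _ : Fin 2 => Set.Icc (0:ℝ) 1)))
    (hμ₂c : ContinuousOn (fun z : Fin 2 → ℝ => μ₂ (z 0) (z 1)) (Set.pi Set.univ (fun _ : Fin 2 => Set.Icc (0:ℝ) 1)))
    (hℓ₃c : ContinuousOn (fun z : Fin 2 → ℝ => ℓ₃ (z 0) (z 1)) (Set.pi Set.univ (fun _ : Fin 2 => Set.Icc (0:ℝ) 1)))
    (hℓ₃ᵥc : ContinuousOn (fun z : Fin 2 → ℝ => ℓ₃ᵥ (z 0) (z 1)) (Set.pi Set.univ (fun _ : Fin 2 => Set.Icc (0:ℝ) 1)))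
    (hμ₃c : ContinuousOn (fun z : Fin 2 → ℝ => μ₃ (z 0) (z 1)) (Set.pi Set.univ (fun _ : Fin 2 => Set.Icc (0:ℝ) 1)))
    (hdv₁ : ∀ s ∈ Set.Icc (0:ℝ) 1, ∀ v ∈ Set.Ioo (0:ℝ) 1, HasDerivAt (fun r => ℓ₁ s r) (ℓ₁ᵥ s v) v)
    (hds₁ : ∀ v ∈ Set.Icc (0:ℝ) 1, ∀ s ∈ Set.Ioo (0:ℝ) 1, HasDerivAt (fun r => μ₁ r v) (ℓ₁ᵥ s v) s)
    (hμ₁0 : ∀ v ∈ Set.Icc (0:ℝ) 1, μ₁ 0 v = 0)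
    (hdv₂ : ∀ s ∈ Set.Icc (0:ℝ) 1, ∀ v ∈ Set.Ioo (0:ℝ) 1, HasDerivAt (fun r => ℓ₂ s r) (ℓ₂ᵥ s v) v)
    (hds₂ : ∀ v ∈ Set.Icc (0:ℝ) 1, ∀ s ∈ Set.Ioo (0:ℝ) 1, HasDerivAt (fun r => μ₂ r v) (ℓ₂ᵥ s v) s)
    (hμ₂0 : ∀ v ∈ Set.Icc (0:ℝ) 1, μ₂ 0 v = 0)
    (hdv₃ : ∀ s ∈ Set.Icc (0:ℝ) 1, ∀ v ∈ Set.Ioo (0:ℝ) 1, HasDerivAt (fun r => ℓ₃ s r) (ℓ₃ᵥ s v) v)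
    (hds₃ : ∀ v ∈ Set.Icc (0:ℝ) 1, ∀ s ∈ Set.Ioo (0:ℝ) 1, HasDerivAt (fun r => μ₃ r v) (ℓ₃ᵥ s v) s)
    (hμ₃0 : ∀ v ∈ Set.Icc (0:ℝ) 1, μ₃ 0 v = 0) :
    FibStokesDecomposable 4 (fun x =>
      μ₁ 1 (x 3) * ℓ₂ (x 1) (x 3) * ℓ₃ (x 2) (x 3) + ℓ₁ (x 0) (x 3) * μ₂ 1 (x 3) * ℓ₃ (x 2) (x 3) +
          ℓ₁ (x 0) (x 3) * ℓ₂ (x 1) (x 3) * μ₃ 1 (x 3) -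
        (ℓ₁ (x 0) 1 * ℓ₂ (x 1) 1 * ℓ₃ (x 2) 1 - ℓ₁ (x 0) 0 * ℓ₂ (x 1) 0 * ℓ₃ (x 2) 0)) := by
  sorry

/-! ## Rung 25 (lead c6, wave 6): LANDEN'S IDENTITY WITH A PARAMETER — rung 18 fibrewise over a semialgebraic `C¹` path of
arguments `a(v) < 1`, multiplied by a semialgebraic `C¹` coefficient `γ(v)`: on `[0,1]³` (`s = x 0`, `t = x 1`, `v = x 2`)
`γ(v)·Λ_{a(v)}(s,t)` is decomposable, where `Λ_a(s,t) = a/(1−ast) − a/(1−a+ast) + ½a²/((1−as)(1−at))` is the Landen integrand.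
The certificate of rung 18 is closed-form RATIONAL in `(s,t,u,a)`, so it runs with `v` as a SILENT coordinate (no element
along `v`): stubs PL1–PL3 are L1a–L1c with `a ↦ a(x 3)` and the factor `γ(x 3)`, PL4 is L1d (soft leftovers, rung 12 — the
only place where `a′, γ′` are needed). Data: `a, γ` semialgebraic and `C¹` on an open interval `(−δ, 1+δ)`, `a < 1` there. The
tool by which a weight-`n` functional equation differentiated in its parameter is fed back one weight down. -/

/-- STUB (PL1, wave 6, lead c6) **parametric Landen, the `Li₂(au)` part** (`stub_landenPartOne` with `a = a(x 3)`, times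
`γ(x 3)`; `v = x 3` silent): on `[0,1]⁴` the elements `E_u[G = γ·au/(1−aust)]`, `E_t[G = −γ·at/(1−aust)]` (`u = x 2`,
`s = x 0`, `t = x 1`). [cite: Zagier2007Dilogarithm, §I.2] -/
theorem stub_paramLandenPartOne (a γ : ℝ → ℝ) (δ : ℝ) (hδ : 0 < δ)
    (ha : IsSemialgebraicFunOn ℚ {z : Fin 1 → ℝ | z 0 ∈ Set.Ioo (-δ) (1 + δ)} (fun z => a (z 0)))
    (hγ : IsSemialgebraicFunOn ℚ {z : Fin 1 → ℝ | z 0 ∈ Set.Ioo (-δ) (1 + δ)} (fun z => γ (z 0)))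
    (hac : ContDiffOn ℝ 1 a (Set.Ioo (-δ) (1 + δ))) (hγc : ContDiffOn ℝ 1 γ (Set.Ioo (-δ) (1 + δ)))
    (ha1 : ∀ v ∈ Set.Ioo (-δ) (1 + δ), a v < 1) :
    FibStokesDecomposable 4 (fun x => γ (x 3) *
      (a (x 3) / (1 - a (x 3) * x 2 * x 0) - a (x 3) / (1 - a (x 3) * x 0 * x 1))) := by
  sorry

/-- STUB (PL2, wave 6, lead c6) **parametric Landen, the `Li₂(−au/(1−au))` part** (`stub_landenPartTwo` with `a = a(x 3)`,
times `γ(x 3)`): elements `E_u[G = −γ·au/(1−au+aust)]`, `E_t[G = γ·at/((1−au)(1−au+aust))]`.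
[cite: Zagier2007Dilogarithm, §I.2] -/
theorem stub_paramLandenPartTwo (a γ : ℝ → ℝ) (δ : ℝ) (hδ : 0 < δ)
    (ha : IsSemialgebraicFunOn ℚ {z : Fin 1 → ℝ | z 0 ∈ Set.Ioo (-δ) (1 + δ)} (fun z => a (z 0)))
    (hγ : IsSemialgebraicFunOn ℚ {z : Fin 1 → ℝ | z 0 ∈ Set.Ioo (-δ) (1 + δ)} (fun z => γ (z 0)))
    (hac : ContDiffOn ℝ 1 a (Set.Ioo (-δ) (1 + δ))) (hγc : ContDiffOn ℝ 1 γ (Set.Ioo (-δ) (1 + δ)))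
    (ha1 : ∀ v ∈ Set.Ioo (-δ) (1 + δ), a v < 1) :
    FibStokesDecomposable 4 (fun x => γ (x 3) *
      (-(a (x 3) / ((1 - a (x 3) * x 2) * (1 - a (x 3) * x 2 + a (x 3) * x 2 * x 0))) +
        a (x 3) / (1 - a (x 3) + a (x 3) * x 0 * x 1))) := by
  sorry

/-- STUB (PL3, wave 6, lead c6) **parametric Landen, the `½log²(1−au)` part** (`stub_landenPartThree` with `a = a(x 3)`,
times `γ(x 3)`): with `k(s,u) = −au/(1−aus)`, `k_u = −a/(1−aus)²`, `κ(s,u) = −as/(1−aus)`, the elements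
`E_u[G = ½γ·k(s,u)k(t,u)]`, `E_s[G = −γ·κ(s,u)k(t,u)]`. [cite: Zagier2007Dilogarithm, §I.2] -/
theorem stub_paramLandenPartThree (a γ : ℝ → ℝ) (δ : ℝ) (hδ : 0 < δ)
    (ha : IsSemialgebraicFunOn ℚ {z : Fin 1 → ℝ | z 0 ∈ Set.Ioo (-δ) (1 + δ)} (fun z => a (z 0)))
    (hγ : IsSemialgebraicFunOn ℚ {z : Fin 1 → ℝ | z 0 ∈ Set.Ioo (-δ) (1 + δ)} (fun z => γ (z 0)))
    (hac : ContDiffOn ℝ 1 a (Set.Ioo (-δ) (1 + δ))) (hγc : ContDiffOn ℝ 1 γ (Set.Ioo (-δ) (1 + δ)))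
    (ha1 : ∀ v ∈ Set.Ioo (-δ) (1 + δ), a v < 1) :
    FibStokesDecomposable 4 (fun x => γ (x 3) *
      ((1 / 2) * ((-(a (x 3) * x 2) / (1 - a (x 3) * x 2 * x 0)) * (-a (x 3) / (1 - a (x 3) * x 2 * x 1) ^ 2) -
          (-a (x 3) / (1 - a (x 3) * x 2 * x 0) ^ 2) * (-(a (x 3) * x 2) / (1 - a (x 3) * x 2 * x 1))) +
        (-a (x 3) / (1 - a (x 3) * x 2)) * (-(a (x 3) * x 2) / (1 - a (x 3) * x 2 * x 1)) -
        (1 / 2) * ((-a (x 3) / (1 - a (x 3) * x 0)) * (-a (x 3) / (1 - a (x 3) * x 1))))) := by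
  sorry

/-- STUB (PL4, wave 6, lead c6) **parametric Landen, the leftovers are soft** (`stub_landenLeftovers` with `a = a(x 3)`, times
`γ(x 3)`): `(R₁ + R₂ + R₃)(x₀,x₂) + A + (R₃(x₁,x₂) − R₃(x₀,x₂))` is decomposable by rung 12 alone — the reflection
`x₀ ↦ 1 − x₀` and the transposition `x₀ ↔ x₁` (`landenLeft_sub_comp_reflect/_perm_of_contDiffOn`; all data `C¹` and
`ℚ`-semialgebraic on the open neighbourhood `{x 3 ∈ (−δ,1+δ)} ∩ {denominators > 0}` of the cube — here `a′, γ′` enter).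
[cite: KontsevichZagier2001, §1.2 rules (2), (3)] -/
theorem stub_paramLandenLeftovers (a γ : ℝ → ℝ) (δ : ℝ) (hδ : 0 < δ)
    (ha : IsSemialgebraicFunOn ℚ {z : Fin 1 → ℝ | z 0 ∈ Set.Ioo (-δ) (1 + δ)} (fun z => a (z 0)))
    (hγ : IsSemialgebraicFunOn ℚ {z : Fin 1 → ℝ | z 0 ∈ Set.Ioo (-δ) (1 + δ)} (fun z => γ (z 0)))
    (hac : ContDiffOn ℝ 1 a (Set.Ioo (-δ) (1 + δ))) (hγc : ContDiffOn ℝ 1 γ (Set.Ioo (-δ) (1 + δ)))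
    (ha1 : ∀ v ∈ Set.Ioo (-δ) (1 + δ), a v < 1) :
    FibStokesDecomposable 4 (fun x => γ (x 3) *
      ((a (x 3) / (1 - a (x 3) * x 2 * x 0) - a (x 3) / ((1 - a (x 3) * x 2) * (1 - a (x 3) * x 2 + a (x 3) * x 2 * x 0)) +
          (-a (x 3) / (1 - a (x 3) * x 2)) * (-(a (x 3) * x 2) / (1 - a (x 3) * x 2 * x 0))) +
      (1 / 2) * ((-(a (x 3) * x 2) / (1 - a (x 3) * x 2 * x 0)) * (-a (x 3) / (1 - a (x 3) * x 2 * x 1) ^ 2) -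
          (-a (x 3) / (1 - a (x 3) * x 2 * x 0) ^ 2) * (-(a (x 3) * x 2) / (1 - a (x 3) * x 2 * x 1))) +
      ((-a (x 3) / (1 - a (x 3) * x 2)) * (-(a (x 3) * x 2) / (1 - a (x 3) * x 2 * x 1)) -
        (-a (x 3) / (1 - a (x 3) * x 2)) * (-(a (x 3) * x 2) / (1 - a (x 3) * x 2 * x 0))))) := by
  sorry

/-- **Rung 25 target (lead c6): Landen's identity with a parameter.** For `a, γ` `ℚ`-semialgebraic and `C¹` on an open
interval around `[0,1]` with `a < 1`, the family `γ(v)·Λ_{a(v)}(s,t)` of Landen integrands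
(`Λ_a = a/(1−ast) − a/(1−a+ast) + ½a²/((1−as)(1−at))`, value `Li₂(a) + Li₂(−a/(1−a)) + ½log²(1−a) = 0`) is fibrewise-Stokes
decomposable on `[0,1]³` (`v = x 2`). [cite: Zagier2007Dilogarithm, §I.2] -/
theorem fibStokesDecomposable_paramLanden (a γ : ℝ → ℝ) (δ : ℝ) (hδ : 0 < δ)
    (ha : IsSemialgebraicFunOn ℚ {z : Fin 1 → ℝ | z 0 ∈ Set.Ioo (-δ) (1 + δ)} (fun z => a (z 0)))
    (hγ : IsSemialgebraicFunOn ℚ {z : Fin 1 → ℝ | z 0 ∈ Set.Ioo (-δ) (1 + δ)} (fun z => γ (z 0)))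
    (hac : ContDiffOn ℝ 1 a (Set.Ioo (-δ) (1 + δ))) (hγc : ContDiffOn ℝ 1 γ (Set.Ioo (-δ) (1 + δ)))
    (ha1 : ∀ v ∈ Set.Ioo (-δ) (1 + δ), a v < 1) :
    FibStokesDecomposable 3 (fun x => γ (x 2) * (a (x 2) / (1 - a (x 2) * x 0 * x 1) -
      a (x 2) / (1 - a (x 2) + a (x 2) * x 0 * x 1) +
      (1 / 2) * ((-a (x 2) / (1 - a (x 2) * x 0)) * (-a (x 2) / (1 - a (x 2) * x 1))))) := by
  sorry

/-! ## Rung 26 (lead c6): THE TRILOGARITHM — the weight-three Landen–Kummer–Euler combination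
`G(x) = Li₃(x) + Li₃(1−x) + Li₃(−x/(1−x)) − log(1−x)·(Li₂(x) + Li₂(1−x)) − ½log x·log²(1−x) − ⅙log³(1−x)` (value `ζ(3)` for
`0 < x < 1`: Landen's trilogarithm identity with Euler's `π²/6 = Li₂(x) + Li₂(1−x) + log x log(1−x)` substituted for the
constant) is CONSTANT modulo Dec along algebraic `x ∈ (0,1)`. Mechanism: `G′(x) = Λ_x-value/(x(1−x))` EXACTLY (the derivative
of the weight-3 identity is Landen's weight-2 identity with a rational coefficient), so the homotopy `x(v) = x₁ + (x₂−x₁)v`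
(tools G3 ×3, PH2 ×2, PH3 ×2) leaves, up to transpositions (rung 12), `γ(v)·Λ_{x(v)}(s,t)` with `γ = x′/(x(1−x))` — rung 25.
The first weight-three functional equation in S2's economy; the anchor `ζ(3)` is not claimed (frontier). -/

/-- **Rung 26 target (lead c6): the trilogarithm combination is constant modulo Dec.** For real algebraic
`0 < x₁, x₂ < 1`, the difference of the cube integrands on `[0,1]³` of `G(x₂)` and `G(x₁)`, where
`G(x) = Li₃(x) + Li₃(1−x) + Li₃(−x/(1−x)) − log(1−x)(Li₂(x) + Li₂(1−x)) − ½log x log²(1−x) − ⅙log³(1−x)` (`= ζ(3)`;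
`Li₃(w) ↦ w/(1−wstu)`, `Li₂(w) ↦ w/(1−wst)`, `log(1−x) ↦ ∫₀¹ −x/(1−xu) du`, `log x ↦ ∫₀¹ −(1−x)/(1−(1−x)s) ds`), is
fibrewise-Stokes decomposable. [cite: Zagier2007Dilogarithm, §I.2] -/
theorem fibStokesDecomposable_trilogLanden_sub (x₁ x₂ : ℝ) (h₁ : IsAlgebraic ℚ x₁) (h₂ : IsAlgebraic ℚ x₂)
    (h₁0 : 0 < x₁) (h₁1 : x₁ < 1) (h₂0 : 0 < x₂) (h₂1 : x₂ < 1) :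
    FibStokesDecomposable 3 (fun z =>
      (x₂ / (1 - x₂ * z 0 * z 1 * z 2) + (1 - x₂) / (1 - (1 - x₂) * z 0 * z 1 * z 2) +
            (-x₂) / (1 - x₂ + x₂ * z 0 * z 1 * z 2) -
          (-x₂ / (1 - x₂ * z 2)) * (x₂ / (1 - x₂ * z 0 * z 1)) -
          (-x₂ / (1 - x₂ * z 2)) * ((1 - x₂) / (1 - (1 - x₂) * z 0 * z 1)) -
          (1 / 2) * ((-(1 - x₂) / (1 - (1 - x₂) * z 0)) * (-x₂ / (1 - x₂ * z 1)) * (-x₂ / (1 - x₂ * z 2))) -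
          (1 / 6) * ((-x₂ / (1 - x₂ * z 0)) * (-x₂ / (1 - x₂ * z 1)) * (-x₂ / (1 - x₂ * z 2)))) -
      (x₁ / (1 - x₁ * z 0 * z 1 * z 2) + (1 - x₁) / (1 - (1 - x₁) * z 0 * z 1 * z 2) +
            (-x₁) / (1 - x₁ + x₁ * z 0 * z 1 * z 2) -
          (-x₁ / (1 - x₁ * z 2)) * (x₁ / (1 - x₁ * z 0 * z 1)) -
          (-x₁ / (1 - x₁ * z 2)) * ((1 - x₁) / (1 - (1 - x₁) * z 0 * z 1)) -
          (1 / 2) * ((-(1 - x₁) / (1 - (1 - x₁) * z 0)) * (-x₁ / (1 - x₁ * z 1)) * (-x₁ / (1 - x₁ * z 2))) -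
          (1 / 6) * ((-x₁ / (1 - x₁ * z 0)) * (-x₁ / (1 - x₁ * z 1)) * (-x₁ / (1 - x₁ * z 2))))) := by
  sorry


/-! ## Rung 26 sub-assemblies (lead c6; registered so that the three rung-26 files can land one by one): part A = the seven
homotopy instances along `x(v) = x₁ + (x₂−x₁)v` (A1–A3 `Li₃`, A4/A5 `log·Li₂` packaged with `(ε,c) ∈ {(1,0),(−1,1)}`, A6/A7 the
triple logs likewise), part B = Landen-with-parameter instantiated (B1) and the decomposability of the summed leftovers (B2). -/

/-- (A1) `Li₃(x(v))`: the weight-three argument homotopy (G3) along the affine path. [cite: Zagier2007Dilogarithm, §I.2] -/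
theorem trilog_termLi3 (x₁ x₂ : ℝ) (h₁ : IsAlgebraic ℚ x₁) (h₂ : IsAlgebraic ℚ x₂)
    (h₁0 : 0 < x₁) (h₁1 : x₁ < 1) (h₂0 : 0 < x₂) (h₂1 : x₂ < 1) :
    FibStokesDecomposable 4 (fun x => (x₂ - x₁) / (1 - (x₁ + (x₂ - x₁) * x 3) * x 0 * x 1) -
      ((x₁ + (x₂ - x₁) * 1) / (1 - (x₁ + (x₂ - x₁) * 1) * x 0 * x 1 * x 2) -
        (x₁ + (x₂ - x₁) * 0) / (1 - (x₁ + (x₂ - x₁) * 0) * x 0 * x 1 * x 2))) := by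
  sorry

/-- (A2) `Li₃(1 − x(v))`: G3 along the path `1 − x(v)`. [cite: Zagier2007Dilogarithm, §I.2] -/
theorem trilog_termLi3' (x₁ x₂ : ℝ) (h₁ : IsAlgebraic ℚ x₁) (h₂ : IsAlgebraic ℚ x₂)
    (h₁0 : 0 < x₁) (h₁1 : x₁ < 1) (h₂0 : 0 < x₂) (h₂1 : x₂ < 1) :
    FibStokesDecomposable 4 (fun x => -(x₂ - x₁) / (1 - (1 - (x₁ + (x₂ - x₁) * x 3)) * x 0 * x 1) -
      ((1 - (x₁ + (x₂ - x₁) * 1)) / (1 - (1 - (x₁ + (x₂ - x₁) * 1)) * x 0 * x 1 * x 2) -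
        (1 - (x₁ + (x₂ - x₁) * 0)) / (1 - (1 - (x₁ + (x₂ - x₁) * 0)) * x 0 * x 1 * x 2))) := by
  sorry

/-- (A3) `Li₃(−x/(1−x))` along the path: G3 with `w = −x(v)/(1−x(v))`, `w′ = −(x₂−x₁)/(1−x(v))²`.
[cite: Zagier2007Dilogarithm, §I.2] -/
theorem trilog_termLi3w (x₁ x₂ : ℝ) (h₁ : IsAlgebraic ℚ x₁) (h₂ : IsAlgebraic ℚ x₂)
    (h₁0 : 0 < x₁) (h₁1 : x₁ < 1) (h₂0 : 0 < x₂) (h₂1 : x₂ < 1) :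
    FibStokesDecomposable 4 (fun x =>
      (-(x₂ - x₁) / (1 - (x₁ + (x₂ - x₁) * x 3)) ^ 2) /
          (1 - (-(x₁ + (x₂ - x₁) * x 3) / (1 - (x₁ + (x₂ - x₁) * x 3))) * x 0 * x 1) -
      ((-(x₁ + (x₂ - x₁) * 1) / (1 - (x₁ + (x₂ - x₁) * 1))) /
            (1 - (-(x₁ + (x₂ - x₁) * 1) / (1 - (x₁ + (x₂ - x₁) * 1))) * x 0 * x 1 * x 2) -
        (-(x₁ + (x₂ - x₁) * 0) / (1 - (x₁ + (x₂ - x₁) * 0))) /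
            (1 - (-(x₁ + (x₂ - x₁) * 0) / (1 - (x₁ + (x₂ - x₁) * 0))) * x 0 * x 1 * x 2))) := by
  sorry

/-- (A4/A5 data) the `log(1−x(v))` family `ℓ(u,v) = −x/(1−xu)` and the `Li₂(w(v))` families, packaged once: PH2 for
`−ℓ(u,v)·T_w(s,t,v)` with `w = x(v)` (`ε = 1, c = 0`) or `w = 1 − x(v)` (`ε = −1, c = 1`), i.e. `w = c + εx`, `w′ = ε(x₂−x₁)`.
[cite: Zagier2007Dilogarithm, §I.2] -/
theorem trilog_termLogLi2 (x₁ x₂ : ℝ) (h₁ : IsAlgebraic ℚ x₁) (h₂ : IsAlgebraic ℚ x₂)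
    (h₁0 : 0 < x₁) (h₁1 : x₁ < 1) (h₂0 : 0 < x₂) (h₂1 : x₂ < 1) (ε c : ℝ) (hεc : (ε = 1 ∧ c = 0) ∨ (ε = -1 ∧ c = 1)) :
    FibStokesDecomposable 4 (fun x =>
      (-(x₂ - x₁) * 1 / (1 - (x₁ + (x₂ - x₁) * x 3) * 1)) *
            ((c + ε * (x₁ + (x₂ - x₁) * x 3)) / (1 - (c + ε * (x₁ + (x₂ - x₁) * x 3)) * x 0 * x 1)) +
          (-(x₁ + (x₂ - x₁) * x 3) / (1 - (x₁ + (x₂ - x₁) * x 3) * x 2)) *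
            (ε * (x₂ - x₁) * 1 / (1 - (c + ε * (x₁ + (x₂ - x₁) * x 3)) * x 0 * 1)) -
        ((-(x₁ + (x₂ - x₁) * 1) / (1 - (x₁ + (x₂ - x₁) * 1) * x 2)) *
            ((c + ε * (x₁ + (x₂ - x₁) * 1)) / (1 - (c + ε * (x₁ + (x₂ - x₁) * 1)) * x 0 * x 1)) -
          (-(x₁ + (x₂ - x₁) * 0) / (1 - (x₁ + (x₂ - x₁) * 0) * x 2)) *
            ((c + ε * (x₁ + (x₂ - x₁) * 0)) / (1 - (c + ε * (x₁ + (x₂ - x₁) * 0)) * x 0 * x 1)))) := by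
  sorry

/-- (A6/A7) the triple log products `ℓ_w(x0)·λ(x1)·λ(x2)` with `ℓ_w(r,v) = −w/(1−wr)`, `w = c + εx(v)` (`κ = ℓ_{1−x}` for
`log x`, `λ = ℓ_x` for `log(1−x)`): PH3 with the closed-form primitives `μ_w(r,v) = −w′r/(1−wr)`, `w′ = ε(x₂−x₁)`.
[cite: Zagier2007Dilogarithm, §I.2] -/
theorem trilog_termLogs (x₁ x₂ : ℝ) (h₁ : IsAlgebraic ℚ x₁) (h₂ : IsAlgebraic ℚ x₂)
    (h₁0 : 0 < x₁) (h₁1 : x₁ < 1) (h₂0 : 0 < x₂) (h₂1 : x₂ < 1) (ε c : ℝ) (hεc : (ε = 1 ∧ c = 0) ∨ (ε = -1 ∧ c = 1)) :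
    FibStokesDecomposable 4 (fun x =>
      (-(ε * (x₂ - x₁)) * 1 / (1 - (c + ε * (x₁ + (x₂ - x₁) * x 3)) * 1)) *
              (-(x₁ + (x₂ - x₁) * x 3) / (1 - (x₁ + (x₂ - x₁) * x 3) * x 1)) *
            (-(x₁ + (x₂ - x₁) * x 3) / (1 - (x₁ + (x₂ - x₁) * x 3) * x 2)) +
          (-(c + ε * (x₁ + (x₂ - x₁) * x 3)) / (1 - (c + ε * (x₁ + (x₂ - x₁) * x 3)) * x 0)) *
              (-(x₂ - x₁) * 1 / (1 - (x₁ + (x₂ - x₁) * x 3) * 1)) *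
            (-(x₁ + (x₂ - x₁) * x 3) / (1 - (x₁ + (x₂ - x₁) * x 3) * x 2)) +
          (-(c + ε * (x₁ + (x₂ - x₁) * x 3)) / (1 - (c + ε * (x₁ + (x₂ - x₁) * x 3)) * x 0)) *
              (-(x₁ + (x₂ - x₁) * x 3) / (1 - (x₁ + (x₂ - x₁) * x 3) * x 1)) *
            (-(x₂ - x₁) * 1 / (1 - (x₁ + (x₂ - x₁) * x 3) * 1)) -
        ((-(c + ε * (x₁ + (x₂ - x₁) * 1)) / (1 - (c + ε * (x₁ + (x₂ - x₁) * 1)) * x 0)) *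
              (-(x₁ + (x₂ - x₁) * 1) / (1 - (x₁ + (x₂ - x₁) * 1) * x 1)) *
            (-(x₁ + (x₂ - x₁) * 1) / (1 - (x₁ + (x₂ - x₁) * 1) * x 2)) -
          (-(c + ε * (x₁ + (x₂ - x₁) * 0)) / (1 - (c + ε * (x₁ + (x₂ - x₁) * 0)) * x 0)) *
              (-(x₁ + (x₂ - x₁) * 0) / (1 - (x₁ + (x₂ - x₁) * 0) * x 1)) *
            (-(x₁ + (x₂ - x₁) * 0) / (1 - (x₁ + (x₂ - x₁) * 0) * x 2)))) := by
  sorry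

/-- (B1) Rung 25 instantiated along the path: `γ(v)·Λ_{x(v)}(s,t)` with `γ = x′/(x(1−x))`, read on `[0,1]⁴` along
`(s,t,v) = (x 0, x 1, x 3)`. [cite: Zagier2007Dilogarithm, §I.2] -/
theorem trilog_paramLanden (x₁ x₂ : ℝ) (h₁ : IsAlgebraic ℚ x₁) (h₂ : IsAlgebraic ℚ x₂)
    (h₁0 : 0 < x₁) (h₁1 : x₁ < 1) (h₂0 : 0 < x₂) (h₂1 : x₂ < 1) :
    FibStokesDecomposable 4 (fun x =>
      (x₂ - x₁) / ((x₁ + (x₂ - x₁) * x 3) * (1 - (x₁ + (x₂ - x₁) * x 3))) *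
        ((x₁ + (x₂ - x₁) * x 3) / (1 - (x₁ + (x₂ - x₁) * x 3) * x 0 * x 1) -
          (x₁ + (x₂ - x₁) * x 3) / (1 - (x₁ + (x₂ - x₁) * x 3) + (x₁ + (x₂ - x₁) * x 3) * x 0 * x 1) +
          (1 / 2) * ((-(x₁ + (x₂ - x₁) * x 3) / (1 - (x₁ + (x₂ - x₁) * x 3) * x 0)) *
            (-(x₁ + (x₂ - x₁) * x 3) / (1 - (x₁ + (x₂ - x₁) * x 3) * x 1))))) := by
  sorry

/-- (B2) **The leftovers of rung 26 are decomposable.** The seven one-weight-down leftovers of the homotopy (A1–A7), summed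
with their coefficients `1, 1, 1, −1, −1, −½, −⅙`, equal `γ(v)·Λ_{x(v)}(s,t)` (`γ = x′/(x(1−x))`: the derivative of the
weight-three identity IS Landen's identity) up to three transposition relators with `C¹` rational coefficients
(`c₀₂ = x′(1/x + 1/(6(1−x)))` on `λ(s)λ(u) − λ(s)λ(t)`, `c₁₂ = x′(−1/(2x) + 1/(6(1−x)))` on `λ(t)λ(u) − λ(s)λ(t)`,
`e = −x′/(2(1−x))` on `κ(s)λ(u) − κ(s)λ(t)`; `λ(r) = −x/(1−xr)`, `κ(r) = −(1−x)/(1−(1−x)r)`), hence are decomposable by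
rung 25 (B1) and rung 12. [cite: Zagier2007Dilogarithm, §I.2] -/
theorem trilog_leftovers (x₁ x₂ : ℝ) (h₁ : IsAlgebraic ℚ x₁) (h₂ : IsAlgebraic ℚ x₂)
    (h₁0 : 0 < x₁) (h₁1 : x₁ < 1) (h₂0 : 0 < x₂) (h₂1 : x₂ < 1) :
    FibStokesDecomposable 4 (fun x =>
      -- (1) + (2) + (3): the three `Li₃` leftovers
      (x₂ - x₁) / (1 - (x₁ + (x₂ - x₁) * x 3) * x 0 * x 1) +
      -(x₂ - x₁) / (1 - (1 - (x₁ + (x₂ - x₁) * x 3)) * x 0 * x 1) +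
      (-(x₂ - x₁) / (1 - (x₁ + (x₂ - x₁) * x 3)) ^ 2) /
          (1 - (-(x₁ + (x₂ - x₁) * x 3) / (1 - (x₁ + (x₂ - x₁) * x 3))) * x 0 * x 1) -
      -- (4), (5): the `log(1−x)·Li₂` leftovers
      ((-(x₂ - x₁) / (1 - (x₁ + (x₂ - x₁) * x 3))) *
            ((x₁ + (x₂ - x₁) * x 3) / (1 - (x₁ + (x₂ - x₁) * x 3) * x 0 * x 1)) +
          (-(x₁ + (x₂ - x₁) * x 3) / (1 - (x₁ + (x₂ - x₁) * x 3) * x 2)) *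
            ((x₂ - x₁) / (1 - (x₁ + (x₂ - x₁) * x 3) * x 0))) -
      ((-(x₂ - x₁) / (1 - (x₁ + (x₂ - x₁) * x 3))) *
            ((1 - (x₁ + (x₂ - x₁) * x 3)) / (1 - (1 - (x₁ + (x₂ - x₁) * x 3)) * x 0 * x 1)) +
          (-(x₁ + (x₂ - x₁) * x 3) / (1 - (x₁ + (x₂ - x₁) * x 3) * x 2)) *
            (-(x₂ - x₁) / (1 - (1 - (x₁ + (x₂ - x₁) * x 3)) * x 0))) -
      -- (6): `−½ κλλ`
      (1 / 2) * (((x₂ - x₁) / (1 - (1 - (x₁ + (x₂ - x₁) * x 3)))) *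
              (-(x₁ + (x₂ - x₁) * x 3) / (1 - (x₁ + (x₂ - x₁) * x 3) * x 1)) *
            (-(x₁ + (x₂ - x₁) * x 3) / (1 - (x₁ + (x₂ - x₁) * x 3) * x 2)) +
          (-(1 - (x₁ + (x₂ - x₁) * x 3)) / (1 - (1 - (x₁ + (x₂ - x₁) * x 3)) * x 0)) *
              (-(x₂ - x₁) / (1 - (x₁ + (x₂ - x₁) * x 3))) *
            (-(x₁ + (x₂ - x₁) * x 3) / (1 - (x₁ + (x₂ - x₁) * x 3) * x 2)) +
          (-(1 - (x₁ + (x₂ - x₁) * x 3)) / (1 - (1 - (x₁ + (x₂ - x₁) * x 3)) * x 0)) *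
              (-(x₁ + (x₂ - x₁) * x 3) / (1 - (x₁ + (x₂ - x₁) * x 3) * x 1)) *
            (-(x₂ - x₁) / (1 - (x₁ + (x₂ - x₁) * x 3)))) -
      -- (7): `−⅙ λλλ`
      (1 / 6) * ((-(x₂ - x₁) / (1 - (x₁ + (x₂ - x₁) * x 3))) *
              (-(x₁ + (x₂ - x₁) * x 3) / (1 - (x₁ + (x₂ - x₁) * x 3) * x 1)) *
            (-(x₁ + (x₂ - x₁) * x 3) / (1 - (x₁ + (x₂ - x₁) * x 3) * x 2)) +
          (-(x₁ + (x₂ - x₁) * x 3) / (1 - (x₁ + (x₂ - x₁) * x 3) * x 0)) *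
              (-(x₂ - x₁) / (1 - (x₁ + (x₂ - x₁) * x 3))) *
            (-(x₁ + (x₂ - x₁) * x 3) / (1 - (x₁ + (x₂ - x₁) * x 3) * x 2)) +
          (-(x₁ + (x₂ - x₁) * x 3) / (1 - (x₁ + (x₂ - x₁) * x 3) * x 0)) *
              (-(x₁ + (x₂ - x₁) * x 3) / (1 - (x₁ + (x₂ - x₁) * x 3) * x 1)) *
            (-(x₂ - x₁) / (1 - (x₁ + (x₂ - x₁) * x 3))))) := by
  sorry

/-! ## Rung 27 (lead c6, wave 7): SECTOR DECOMPOSITION BY THE LARGEST COORDINATE is in S2's economy, every dimension — the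
cube `[0,1]^{N+1}` is the union of the `N+1` pyramids `{x_j = max}`, each parametrised from the apex `0` by the blow-down
`y ↦ y_j·y[j ↦ 1]` (Jacobian `y_j^N`); the relator `f − Σ_j y_j^N f(y_j·y[j ↦ 1])` is decomposable although the blow-downs
COLLAPSE a face (so rungs 13–15 do not apply): the radial scaling homotopy `r ↦ r·x` towards the apex on `[0,1]^{N+2}`, with the
Euler identity `∂_r[r^{N+1} f(rx)] = Σ_j ∂_j[r^N x_j f(rx)]`, has faces `−f(x) + Σ_j r^N f(r·x[j ↦ 1])`, and each pyramid term is
moved onto its own slot by rung 11. At `N+1 = 2` this is KUHN'S SUBDIVISION `f(s,t) ≡ s f(s,st) + t f(ts,t)` = the SHUFFLE of two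
one-dimensional integrals; iterated, it cubifies Kuhn's triangulation, Kontsevich's simplex charts of multiple zeta values and the
sector decompositions that bound logarithmic corner singularities (frontier C2(c), C4 and the anchor programme). -/

/-- STUB (SD, wave 7, lead c6) **sector decomposition by the largest coordinate.** For `f` `ℚ`-semialgebraic and `C¹` on an
open `U ⊇ [0,1]^{N+1}`, the relator `f(x) − Σ_j x_j^N · f(x_j • x[j ↦ 1])` (`x_j • x[j ↦ 1]` = the point with coordinates
`x_j x_i` for `i ≠ j` and `x_j` at `j`: the pyramid `{x_j maximal}` parametrised by the cube, Jacobian `x_j^N`) is fibrewise-Stokes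
decomposable on `[0,1]^{N+1}`. Certificate on `[0,1]^{N+2}` (`r` = the last coordinate): `E_r[G = r^{N+1} f(r x)]`,
`E_{x_j}[G = −r^N x_j f(r x)]` (`∂_r[r^{N+1}f(rx)] = (N+1)r^N f(rx) + r^{N+1}Σ_j x_j∂_jf(rx) = Σ_j ∂_{x_j}[r^N x_j f(rx)]`; faces
`f(x) − 0` and `−r^N f(r·x[j ↦ 1]) + 0`), then `fibStokesDecomposable_moveCoord` (rung 11) moves each pyramid term
`p_j(y) = y_j^N f(y_j • y[j ↦ 1])` from the slot `r` back to the slot `j`, and un-pad. [cite: KontsevichZagier2001, §1.2 rules (2), (3)] -/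
theorem stub_sectorDecomposition {N : ℕ} (U : Set (Fin (N + 1) → ℝ)) (hU : IsOpen U)
    (hCU : Set.pi Set.univ (fun _ : Fin (N + 1) => Set.Icc (0:ℝ) 1) ⊆ U) (f : (Fin (N + 1) → ℝ) → ℝ)
    (hf : IsSemialgebraicFunOn ℚ U f) (hfd : ContDiffOn ℝ 1 f U) :
    FibStokesDecomposable (N + 1) (fun x => f x -
      ∑ j : Fin (N + 1), x j ^ N * f (Function.update (x j • x) j (x j))) := by
  sorry

/-! ## Rung 27 corollary (lead c6): the SHUFFLE of two one-dimensional integrals (Kuhn's subdivision of the square) —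
`stub_sectorDecomposition` at `N+1 = 2` for `f(s,t) = k₁(s)k₂(t)`. -/

/-- **The shuffle product of two one-dimensional integrals is in S2's economy (rung 27 at `N+1 = 2`, lead c6).** For `k₁, k₂`
`ℚ`-semialgebraic and `C¹` on an open interval `I ⊇ [0,1]`, the cube integrand `k₁(s)k₂(t)` of the product `(∫₀¹k₁)(∫₀¹k₂)` is
congruent modulo Dec to the sum of the two ITERATED integrands `s·k₁(s)k₂(st)` (`∫∫_{t<s}`) and `t·k₁(ts)k₂(t)` (`∫∫_{s<t}`):
Kuhn's subdivision of the square, i.e. `stub_sectorDecomposition` for `f(s,t) = k₁(s)k₂(t)`. For `kᵢ(s) = aᵢ/(1 − aᵢs)`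
(`|aᵢ| < 1`) this is the shuffle relation `log(1−a₁)log(1−a₂) = Li_{1,1}(a₂… )+ Li_{1,1}(a₁…)` of depth-two iterated
integrals; in general it is the geometric half of the double-shuffle structure. [cite: KontsevichZagier2001, §1.2 rules (1), (2)] -/
theorem fibStokesDecomposable_shuffleTwo (I : Set ℝ) (hI : IsOpen I) (hIcc : Set.Icc (0:ℝ) 1 ⊆ I) (k₁ k₂ : ℝ → ℝ)
    (hk₁ : IsSemialgebraicFunOn ℚ {z : Fin 1 → ℝ | z 0 ∈ I} (fun z => k₁ (z 0)))
    (hk₂ : IsSemialgebraicFunOn ℚ {z : Fin 1 → ℝ | z 0 ∈ I} (fun z => k₂ (z 0)))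
    (hk₁d : ContDiffOn ℝ 1 k₁ I) (hk₂d : ContDiffOn ℝ 1 k₂ I) :
    FibStokesDecomposable 2 (fun z => k₁ (z 0) * k₂ (z 1) -
      (z 0 * (k₁ (z 0) * k₂ (z 0 * z 1)) + z 1 * (k₁ (z 1 * z 0) * k₂ (z 1)))) := by
  sorry

/-! ## Rung 27′ (lead c6, wave 9): sector decomposition with SILENT coordinates — `stub_sectorDecomposition` on the head block of
`[0,1]^{(N+1)+M}`, the tail block of `M` coordinates carried as parameters (no element along them). Needed to iterate the sector
decomposition (Kuhn's triangulation into `(N+1)!` simplices = all shuffles of iterated integrals) and inside homotopies. -/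

/-- STUB (SDP, wave 9, lead c6) **sector decomposition by the largest HEAD coordinate, with parameters.** For `f`
`ℚ`-semialgebraic and `C¹` on an open `U ⊇ [0,1]^{(N+1)+M}`, writing `x = (xh, xt)` (`xh = x ∘ Fin.castAdd M` the head,
`xt = x ∘ Fin.natAdd (N+1)` the tail), the relator `f(x) − Σ_{j ≤ N} xh_j^N · f(xh_j • xh[j ↦ 1], xt)` is fibrewise-Stokes
decomposable on `[0,1]^{(N+1)+M}`: the radial homotopy of rung 27 in the head block only (`E_r[G = r^{N+1} f(r•xh, xt)]`,
`E_{xh_j}[G = −r^N xh_j f(r•xh, xt)]`, faces `−f + Σ_j r^N f(r•xh[j↦1], xt)`), then `fibStokesDecomposable_moveCoord` per `j`.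
[cite: KontsevichZagier2001, §1.2 rules (2), (3)] -/
theorem stub_sectorDecompositionParam {N M : ℕ} (U : Set (Fin (N + 1 + M) → ℝ)) (hU : IsOpen U)
    (hCU : Set.pi Set.univ (fun _ : Fin (N + 1 + M) => Set.Icc (0:ℝ) 1) ⊆ U) (f : (Fin (N + 1 + M) → ℝ) → ℝ)
    (hf : IsSemialgebraicFunOn ℚ U f) (hfd : ContDiffOn ℝ 1 f U) :
    FibStokesDecomposable (N + 1 + M) (fun x => f x -
      ∑ j : Fin (N + 1), x (Fin.castAdd M j) ^ N *
        f (Fin.append (Function.update (x (Fin.castAdd M j) • (fun a => x (Fin.castAdd M a))) j (x (Fin.castAdd M j)))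
          (fun b => x (Fin.natAdd (N + 1) b)))) := by
  sorry

/-! ## Rung 28 (lead c6, wave 7): the INVERSION relation of the dilogarithm, `Li₂(−x) + Li₂(−1/x) + ½log²x = −π²/6` (`x > 0`),
is CONSTANT modulo Dec along algebraic `x > 0` (homotopy as in rung 20; the anchor `−π²/6` is not claimed). Its one-dimensional
leftover is the parametric dlog certificate of the loop `P(s) = (x+s)(1+(x−1)s)/(x(1+xs))` below; with Landen (18), five-term (19),
Euler (20), duplication (16) this completes the classical functional equations of `Li₂` modulo constants. -/

/-- STUB (HC, wave 7, lead c6) **parametric dlog certificate for the inversion loop**: along the path `x(v) = x₁ + (x₂−x₁)v > 0`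
(`v = x 2` silent, `s = x 0`, homotopy `y = x 1`), with a semialgebraic continuous coefficient `γ(v)`, the three-term
combination `γ(v)·(−1/(1+xs) + 1/(x(x+s)) + (x−1)/(x(1+(x−1)s)))` (`= γ·P′/(xP)` for the loop
`P(s) = (x+s)(1+(x−1)s)/(x(1+xs))`, `P(0) = P(1) = 1`; values `−log(1+x)/x + (log(1+x) − log x)/x + log x/x = 0`) is
fibrewise-Stokes decomposable on `[0,1]³`: rung 2's two elements `G₀ = (γ/x)(P−1)/E` along `s`, `G₁ = (γ/x)·y·P′·(1/P − 1/E)` along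
`y`, `E = 1 + (P−1)y` (the pattern of `stub_hillRelationA`). [cite: KontsevichZagier2001, §1.2] -/
theorem stub_inversionLoopCertificate (x₁ x₂ : ℝ) (h₁ : IsAlgebraic ℚ x₁) (h₂ : IsAlgebraic ℚ x₂)
    (h₁0 : 0 < x₁) (h₂0 : 0 < x₂) (γ : ℝ → ℝ)
    (hγ : IsSemialgebraicFunOn ℚ (Set.pi Set.univ (fun _ : Fin 1 => Set.Icc (0:ℝ) 1)) (fun z => γ (z 0)))
    (hγc : ContinuousOn γ (Set.Icc (0:ℝ) 1)) :
    FibStokesDecomposable 3 (fun x => γ (x 2) *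
      (-1 / (1 + (x₁ + (x₂ - x₁) * x 2) * x 0) +
        1 / ((x₁ + (x₂ - x₁) * x 2) * ((x₁ + (x₂ - x₁) * x 2) + x 0)) +
        ((x₁ + (x₂ - x₁) * x 2) - 1) / ((x₁ + (x₂ - x₁) * x 2) * (1 + ((x₁ + (x₂ - x₁) * x 2) - 1) * x 0)))) := by
  sorry

/-- **Rung 28 target (lead c6): the inversion relation is constant modulo Dec.** For real algebraic `x₁, x₂ > 0` the difference
of the cube integrands on `[0,1]²` of `R(x₂)` and `R(x₁)`, `R(x) = Li₂(−x) + Li₂(−1/x) + ½log²x` (`= −π²/6`;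
`Li₂(−x) ↦ −x/(1+xst)`, `Li₂(−1/x) ↦ −1/(x+st)`, `log x ↦ ∫₀¹ (x−1)/(1+(x−1)s) ds`), is fibrewise-Stokes decomposable.
[cite: Zagier2007Dilogarithm, §I.2] -/
theorem fibStokesDecomposable_inversion_sub (x₁ x₂ : ℝ) (h₁ : IsAlgebraic ℚ x₁) (h₂ : IsAlgebraic ℚ x₂)
    (h₁0 : 0 < x₁) (h₂0 : 0 < x₂) :
    FibStokesDecomposable 2 (fun z =>
      (-x₂ / (1 + x₂ * z 0 * z 1) + -1 / (x₂ + z 0 * z 1) +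
          (1 / 2) * (((x₂ - 1) / (1 + (x₂ - 1) * z 0)) * ((x₂ - 1) / (1 + (x₂ - 1) * z 1)))) -
        (-x₁ / (1 + x₁ * z 0 * z 1) + -1 / (x₁ + z 0 * z 1) +
          (1 / 2) * (((x₁ - 1) / (1 + (x₁ - 1) * z 0)) * ((x₁ - 1) / (1 + (x₁ - 1) * z 1))))) := by
  sorry


/-! ## RUNG A (lead c6, cycle 3 main line): `π²` ENTERS S2's ECONOMY — the anchor. All data BOUNDED and smooth on the closed
square. `k₁(w,y) = 4/((1+yw)(1+y−y(1−y)w))` (value `π²/4`) is the corner blow-up `X = 1−(1−y)w, Y = y` of `4/(1−X²Y²)` on the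
sector `{X ≥ Y}`; Calabi–Beukers–Kolk–Calabi / Kontsevich–Zagier's substitution `Φ⁻¹(X,Y) = (X√((1−Y²)/(1−X²)), Y√((1−X²)/(1−Y²)))`
pulls `4dXdY/(1−X²Y²)` back to `g = 4/((1+ξ²)(1+η²))` on `T₁ = {η ≤ ξ, ξη ≤ 1} = L ∪ A′`, `ι : ξ ↦ 1/ξ` maps `A′` onto
`L = {η ≤ ξ ≤ 1}` preserving `g dξdη`, so `∫k₁ = 2∫_L g` and `8w/((1+w²)(1+w²y²)) = 2·(s·g(s,su))` is the chart of `L` from its apex.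
Chain (every intermediate integrand bounded): A1 cut the `(w,y)`-square along `C = Γ⁻¹{ξ=1} = {w = φ(y)}`,
`φ(y) = (1+y)/(√(2−y²)(1+√(2−y²)))` (`stub_subdivisionVar`); A2a reparametrise piece 2 by `w̃ = v²` (rung 13); A2b piece 2 → `L` via
`Ψ₂(v,y) = (v√Q/X, yX)`, `X = 1−(1−y)φv²`, `Q = φ(2−(1−y)φv²)/(1+y)` — a face-preserving ANALYTIC self-map of the closed square —
and rung 15 (`fibStokesDecomposable_sub_pullback`); A3 piece 1 → `L` likewise (chart of `L` from the vertex `(1,1)`); A4 the two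
charts of `L` and `∫_□ g = 2∫_L g` (rungs 21, 27, 12); A5 assembly: `k₁ − 8w/((1+w²)(1+w²y²)) ∈ Dec` and
`k₁ − 4/((1+s²)(1+t²)) ∈ Dec` (value `π²/4 − π²/4`). A0 is Calabi's Jacobian identity, the one transcendental-looking input. -/

/-- STUB (A0, RUNG A, lead c6) **Calabi's substitution, inverse form.** On the open unit square the map
`Φ⁻¹(X,Y) = (X√((1−Y²)/(1−X²)), Y√((1−X²)/(1−Y²)))` (the inverse of Calabi's `x = sin u/cos v, y = sin v/cos u` in the
coordinates `ξ = tan u, η = tan v`) is differentiable with Jacobian determinant `(1 − X²Y²)/((1−X²)(1−Y²))`, and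
`4/((1+ξ²)(1+η²)) · det = 4/(1−X²Y²)` (since `1+ξ² = (1−X²Y²)/(1−X²)`, `1+η² = (1−X²Y²)/(1−Y²)`).
[cite: KontsevichZagier2001, §1.2] -/
theorem stub_calabiJacobian (Ψ : (Fin 2 → ℝ) → (Fin 2 → ℝ))
    (hΨ : Ψ = fun q => ![q 0 * Real.sqrt ((1 - q 1 ^ 2) / (1 - q 0 ^ 2)), q 1 * Real.sqrt ((1 - q 0 ^ 2) / (1 - q 1 ^ 2))])
    (p : Fin 2 → ℝ) (h0 : p 0 ∈ Set.Ioo (0:ℝ) 1) (h1 : p 1 ∈ Set.Ioo (0:ℝ) 1) :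
    DifferentiableAt ℝ Ψ p ∧
      (fderiv ℝ Ψ p).det = (1 - (p 0 * p 1) ^ 2) / ((1 - p 0 ^ 2) * (1 - p 1 ^ 2)) ∧
      4 / ((1 + (Ψ p 0) ^ 2) * (1 + (Ψ p 1) ^ 2)) * (fderiv ℝ Ψ p).det = 4 / (1 - (p 0 * p 1) ^ 2) := by
  sorry

/-- STUB (A1, RUNG A, lead c6) **the cut along `C = {w = φ(y)}`** (`stub_subdivisionVar` along `w = z 0` at the semialgebraic
continuous height `φ(z 1) ∈ [1 − 1/√2, 1]`): `k₁ ≡ φ·k₁(φw, y) + (1−φ)·k₁(φ + (1−φ)w, y)`. [cite: KontsevichZagier2001, §1.2 rules (1), (2)] -/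
theorem stub_anchorCut :
    FibStokesDecomposable 2 (fun z =>
      4 / ((1 + z 1 * z 0) * (1 + z 1 - z 1 * (1 - z 1) * z 0)) -
      (1 + z 1) / (Real.sqrt (2 - z 1 ^ 2) * (1 + Real.sqrt (2 - z 1 ^ 2))) *
        (4 / ((1 + z 1 * ((1 + z 1) / (Real.sqrt (2 - z 1 ^ 2) * (1 + Real.sqrt (2 - z 1 ^ 2))) * z 0)) *
          (1 + z 1 - z 1 * (1 - z 1) * ((1 + z 1) / (Real.sqrt (2 - z 1 ^ 2) * (1 + Real.sqrt (2 - z 1 ^ 2))) * z 0)))) -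
      (1 - (1 + z 1) / (Real.sqrt (2 - z 1 ^ 2) * (1 + Real.sqrt (2 - z 1 ^ 2)))) *
        (4 / ((1 + z 1 * ((1 + z 1) / (Real.sqrt (2 - z 1 ^ 2) * (1 + Real.sqrt (2 - z 1 ^ 2))) +
            (1 - (1 + z 1) / (Real.sqrt (2 - z 1 ^ 2) * (1 + Real.sqrt (2 - z 1 ^ 2)))) * z 0)) *
          (1 + z 1 - z 1 * (1 - z 1) * ((1 + z 1) / (Real.sqrt (2 - z 1 ^ 2) * (1 + Real.sqrt (2 - z 1 ^ 2))) +
            (1 - (1 + z 1) / (Real.sqrt (2 - z 1 ^ 2) * (1 + Real.sqrt (2 - z 1 ^ 2)))) * z 0))))) := by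
  sorry

/-- STUB (A2a, RUNG A, lead c6) **piece 2 reparametrised by `w̃ = v²`** (rung 13 `fibStokesDecomposable_sub_reparam` along `z 0` with
`ψ(x) = x₀²`): `φ·k₁(φw̃, y) ≡ 2v·φ·k₁(φv², y)`. [cite: KontsevichZagier2001, §1.2 rule (2)] -/
theorem stub_anchorSq :
    FibStokesDecomposable 2 (fun z =>
      (1 + z 1) / (Real.sqrt (2 - z 1 ^ 2) * (1 + Real.sqrt (2 - z 1 ^ 2))) *
        (4 / ((1 + z 1 * ((1 + z 1) / (Real.sqrt (2 - z 1 ^ 2) * (1 + Real.sqrt (2 - z 1 ^ 2))) * z 0)) *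
          (1 + z 1 - z 1 * (1 - z 1) * ((1 + z 1) / (Real.sqrt (2 - z 1 ^ 2) * (1 + Real.sqrt (2 - z 1 ^ 2))) * z 0)))) -
      2 * z 0 * ((1 + z 1) / (Real.sqrt (2 - z 1 ^ 2) * (1 + Real.sqrt (2 - z 1 ^ 2))) *
        (4 / ((1 + z 1 * ((1 + z 1) / (Real.sqrt (2 - z 1 ^ 2) * (1 + Real.sqrt (2 - z 1 ^ 2))) * z 0 ^ 2)) *
          (1 + z 1 - z 1 * (1 - z 1) * ((1 + z 1) / (Real.sqrt (2 - z 1 ^ 2) * (1 + Real.sqrt (2 - z 1 ^ 2))) * z 0 ^ 2)))))) := by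
  sorry

/-- STUB (A2b, RUNG A, lead c6) **piece 2 is the apex chart of `L`** — rung 15 (`fibStokesDecomposable_sub_pullback`) for the
face-preserving analytic self-map `Ψ₂(v,y) = (s,u) = (v√Q/X, yX)` of the closed square (`φ = (1+y)/(√(2−y²)(1+√(2−y²)))`,
`X = 1 − (1−y)φv²`, `Q = φ(2−(1−y)φv²)/(1+y)`; faces: `v=0 ↦ s=0`, `v=1 ↦ s=1` (the defining property of `φ`),
`y=0 ↦ u=0`, `y=1 ↦ u=1`) and `h₂(s,u) = 4s/((1+s²)(1+s²u²))` (the chart `(s,su)` of `L = {η ≤ ξ ≤ 1}` for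
`g = 4/((1+ξ²)(1+η²))`): `h₂ − (h₂∘Ψ₂)·det DΨ₂ ∈ Dec`, and `(h₂∘Ψ₂)·det DΨ₂ = 2vφk₁(φv², y)` pointwise — STRUCTURALLY
`Ψ₂ = β₀⁻¹∘ι∘Φ⁻¹∘β∘(v ↦ φv²)` with `β(w,y) = (1−(1−y)w, y)`, Calabi (A0), `ι(ξ,η) = (1/ξ, η)` (`g`-invariant), `β₀(s,u) = (s,su)`;
or by direct differentiation (one radical `√Q`). [cite: KontsevichZagier2001, §1.2 rule (2)] -/
theorem stub_anchorPieceTwo :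
    FibStokesDecomposable 2 (fun z =>
      4 * z 0 / ((1 + z 0 ^ 2) * (1 + z 0 ^ 2 * z 1 ^ 2)) -
      2 * z 0 * ((1 + z 1) / (Real.sqrt (2 - z 1 ^ 2) * (1 + Real.sqrt (2 - z 1 ^ 2))) *
        (4 / ((1 + z 1 * ((1 + z 1) / (Real.sqrt (2 - z 1 ^ 2) * (1 + Real.sqrt (2 - z 1 ^ 2))) * z 0 ^ 2)) *
          (1 + z 1 - z 1 * (1 - z 1) * ((1 + z 1) / (Real.sqrt (2 - z 1 ^ 2) * (1 + Real.sqrt (2 - z 1 ^ 2))) * z 0 ^ 2)))))) := by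
  sorry

/-- STUB (A3, RUNG A, lead c6) **piece 1 is the vertex-`(1,1)` chart of `L`** — rung 15 for the face-preserving analytic
self-map `Ψ₁ = flip₀ ∘ γ⁻¹ ∘ Γ₁` of the closed square, `Γ₁(w̃,y) = Γ(φ + (1−φ)w̃, y)`,
`Γ(w,y) = (ξ,η) = (X√((1+y)/R), y√(R/(1+y)))`, `X = 1−(1−y)w`, `R = w(2−(1−y)w)` (the composite `Φ⁻¹∘β`; the factor `1−y`
cancels), `γ(a,η) = (η + (1−η)a, η)` the chart of `L = {η ≤ ξ ≤ 1}` from its vertex `(1,1)` (Jacobian `1−η`), `flip₀ : a ↦ 1−a`: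
faces `w̃=0 ↦ b=0` (`ξ = 1`), `w̃=1 ↦ b=1` (the diagonal), `y=0 ↦ η=0`, `y=1 ↦ η=1` (both charts collapse that face to the vertex,
at the same linear rate: `b → w̃/(2−w̃)`); `h₁(b,η) = (1−η)·g(η + (1−η)(1−b), η)` and
`(h₁∘Ψ₁)·det DΨ₁ = (1−φ)k₁(φ + (1−φ)w̃, y)` pointwise. [cite: KontsevichZagier2001, §1.2 rule (2)] -/
theorem stub_anchorPieceOne :
    FibStokesDecomposable 2 (fun z =>
      (1 - z 1) * (4 / ((1 + (z 1 + (1 - z 1) * (1 - z 0)) ^ 2) * (1 + z 1 ^ 2))) -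
      (1 - (1 + z 1) / (Real.sqrt (2 - z 1 ^ 2) * (1 + Real.sqrt (2 - z 1 ^ 2)))) *
        (4 / ((1 + z 1 * ((1 + z 1) / (Real.sqrt (2 - z 1 ^ 2) * (1 + Real.sqrt (2 - z 1 ^ 2))) +
            (1 - (1 + z 1) / (Real.sqrt (2 - z 1 ^ 2) * (1 + Real.sqrt (2 - z 1 ^ 2)))) * z 0)) *
          (1 + z 1 - z 1 * (1 - z 1) * ((1 + z 1) / (Real.sqrt (2 - z 1 ^ 2) * (1 + Real.sqrt (2 - z 1 ^ 2))) +
            (1 - (1 + z 1) / (Real.sqrt (2 - z 1 ^ 2) * (1 + Real.sqrt (2 - z 1 ^ 2)))) * z 0))))) := by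
  sorry

/-- (A4a, lead c6) **the two charts of the triangle `L` agree modulo Dec**: the vertex-`(1,1)` chart
`h₁(b,η) = (1−η)g(η+(1−η)(1−b), η)` and the apex chart `h₂(s,u) = s·g(s,su)` of `∫_L g`, `g = 4/((1+ξ²)(1+η²))` — subtract the
variable-height subdivision of the square at `ξ = η` (rung 21) from Kuhn's subdivision (rung 27) and reflect (rung 12).
[cite: KontsevichZagier2001, §1.2 rules (1), (2)] -/
theorem anchor_chartsOfL :
    FibStokesDecomposable 2 (fun z =>
      (1 - z 1) * (4 / ((1 + (z 1 + (1 - z 1) * (1 - z 0)) ^ 2) * (1 + z 1 ^ 2))) -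
        z 0 * (4 / ((1 + z 0 ^ 2) * (1 + (z 0 * z 1) ^ 2)))) := by
  sorry

/-- (A4b, lead c6) **the square is twice the triangle**: `g ≡ 2·h₂` for the symmetric `g = 4/((1+ξ²)(1+η²))` — Kuhn's subdivision
(rung 27) and one transposition (rung 12). [cite: KontsevichZagier2001, §1.2 rules (1), (2)] -/
theorem anchor_boxTwiceL :
    FibStokesDecomposable 2 (fun z =>
      4 / ((1 + z 0 ^ 2) * (1 + z 1 ^ 2)) - 2 * (z 0 * (4 / ((1 + z 0 ^ 2) * (1 + (z 0 * z 1) ^ 2))))) := by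
  sorry

/-- **RUNG A target (lead c6): `π²` in S2's economy.** The bounded smooth cube integrand
`4/((1+yw)(1+y−y(1−y)w)) − 8w/((1+w²)(1+w²y²))` on `[0,1]²` (value `π²/4 − π²/4 = 0`; the first term is a resolved
presentation of `Σ_{n odd} 4/n² = π²/2` halved, the second is `2∫_{η≤ξ≤1} 4dξdη/((1+ξ²)(1+η²)) = 8·(arctan-shuffle)`) is
fibrewise-Stokes decomposable. The first TRANSCENDENTAL CONSTANT inside S2's economy. [cite: KontsevichZagier2001, §1.2] -/
theorem fibStokesDecomposable_anchorPiSq :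
    FibStokesDecomposable 2 (fun z =>
      4 / ((1 + z 1 * z 0) * (1 + z 1 - z 1 * (1 - z 1) * z 0)) - 8 * z 0 / ((1 + z 0 ^ 2) * (1 + z 0 ^ 2 * z 1 ^ 2))) := by
  sorry


/-! ## RUNG A′ (lead c6): from `π²` to EULER — `Li₂(−1) = −π²/12` in S2's economy. `P₁(w,y) = 1/(1+yw)` is at once the cube
integrand of `−Li₂(−1)` and the corner blow-up of `1/(1−xy)` on the sector `{x ≥ y}` (value `ζ(2)/2`); the substitution
`(x,y) = (X²,Y²)` followed by the same blow-up gives `P₂ = Y·X·k₁` (`X = 1−(1−y)w`, `Y = y`), and `k₁ − P₂ = 4(1−y)/(1+yX) = P₄` is the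
blow-up of `4/(1+XY)` on the sector. B1: `P₁ ≡ P₂` by rung 15 along the face-preserving RATIONAL self-map
`T(w,y) = (w(2−(1−y)w)/(1+y), y²)` (the transition between the two blow-ups); B2: `P₄ ≡ 2P₁` (Kuhn − variable-height subdivision,
rung 12); with RUNG A (`k₁ ≡ g`): `g ≡ 3P₁`, i.e. `4/(3(1+s²)(1+t²)) − 1/(1+st) ∈ Dec` — the disprover's target of frontier v4,
answered. -/

/-- STUB (B1, RUNG A′, lead c6) **the two corner blow-ups of `ζ(2)/2` agree**: `P₁(w,y) = 1/(1+yw)` (blow-up `x = 1−(1−y)w` of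
`1/(1−xy)` on `{x ≥ y}`) and `P₂(w,y) = y(1−(1−y)w)·4/((1+yw)(1+y−y(1−y)w))` (substitute `(x,y) = (X²,Y²)` first, then blow up)
differ by the transition map `T(w,y) = (w(2−(1−y)w)/(1+y), y²)`, a face-preserving rational self-map of the closed square, smooth
near it: rung 15 (`fibStokesDecomposable_sub_pullback`) with `h = P₁`, `Φ = T`, and `(P₁∘T)·det DT = P₂` pointwise
(`det DT = 2y·2(1−(1−y)w)/(1+y)`, `1 + y²·w(2−(1−y)w)/(1+y) = (1+yw)(1+y−y(1−y)w)/(1+y)`). [cite: KontsevichZagier2001, §1.2 rule (2)] -/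
theorem stub_anchorChartChange :
    FibStokesDecomposable 2 (fun z => 1 / (1 + z 1 * z 0) -
      z 1 * (1 - (1 - z 1) * z 0) * (4 / ((1 + z 1 * z 0) * (1 + z 1 - z 1 * (1 - z 1) * z 0)))) := by
  sorry

/-- (B2, lead c6) **the sector is half the square**: `P₄(w,y) = 4(1−y)/(1 + y(1−(1−y)w))` — the blow-up from the vertex
`(1,1)` of the sector `{X ≥ Y}` for the symmetric `f = 4/(1+XY)` — is congruent to `2·P₁ = ½f`: Kuhn's subdivision (rung 27),
the variable-height subdivision at `X = Y` (rung 21), one transposition and one reflection (rung 12).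
[cite: KontsevichZagier2001, §1.2 rules (1), (2)] -/
theorem anchor_sectorHalf :
    FibStokesDecomposable 2 (fun z => 4 * (1 - z 1) / (1 + z 1 * (1 - (1 - z 1) * z 0)) - 2 * (1 / (1 + z 1 * z 0))) := by
  sorry

/-- **RUNG A′ target (lead c6): EULER'S `ζ(2) = π²/6` in S2's economy, in the form `Li₂(−1) = −π²/12`.** The bounded smooth
cube integrand `4/(3(1+s²)(1+t²)) − 1/(1+st)` on `[0,1]²` (value `(4/3)(π/4)² − π²/12 = 0`) is fibrewise-Stokes decomposable.
[cite: KontsevichZagier2001, §1.2] -/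
theorem fibStokesDecomposable_anchorEuler :
    FibStokesDecomposable 2 (fun z => 4 / (3 * ((1 + z 0 ^ 2) * (1 + z 1 ^ 2))) - 1 / (1 + z 0 * z 1)) := by
  sorry


/-! ## Rung 17 assembly stub (E2, wave 2): the elliptic translation relator -/

/-! LANDED: `stub_ellipticTranslationRelator` — p138975, `Theorems/UnfoldedStokesStokesGenerationStubEllipticTranslationRelator.lean` (imported above; exact registered signature). -/



/-! ## Lead assemblies of rungs 15 and 18 (registered; to land as `…FibrewiseRungPullback.lean`, `…FibrewiseRungLanden.lean`) -/

/-! LANDED: `fibStokesDecomposable_sub_pullback` — p138979, `Theorems/UnfoldedStokesStokesGenerationFibrewiseRungPullback.lean` (imported above; exact registered signature). -/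

/-! LANDED: `fibStokesDecomposable_landen` — p139998, `Theorems/UnfoldedStokesStokesGenerationFibrewiseRungLanden.lean` (imported above; exact registered signature). -/

/-! ## Sorry-free glue -/

/-- A representation on a Lebesgue-null domain is a relation: `[Z] = [Z ∪ Z] = [Z] + [Z]` is one
domain-additivity move (`Z ∩ Z` null). [cite: KontsevichZagier2001, §1.2 rule (1)] -/
theorem of_mem_relations_of_volume_zero {N : ℕ} (r : IntegralRep N) (h0 : volume r.domain = 0) :
    of r ∈ relations := by
  have h : of r - of r - of r ∈ relations :=
    domainAddRel_subset_relations ⟨N, r, r, r, (Set.union_self _).symm,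
      by rwa [Set.inter_self], fun _ _ => rfl, fun _ _ => rfl, rfl⟩
  have : of r = -(of r - of r - of r) := by abel
  rw [this]
  exact relations.neg_mem h

/-- Rewriting the domain of a representation along a set equality. [folklore] -/
theorem exists_domain_eq {N : ℕ} (r : IntegralRep N) {s : Set (Fin N → ℝ)} (hs : r.domain = s) :
    ∃ r' : IntegralRep N, r'.domain = s ∧ r'.integrand = r.integrand ∧ of r - of r' ∈ relations := by
  subst hs
  exact ⟨r, rfl, rfl, by simp [relations.zero_mem]⟩

/-- **Lifting a cube representation by one slab**: `[□ᴺ, f] ∼ [□ᴺ⁺¹, f ∘ init]` (one Newton–Leibniz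
move with primitive `t · f`, `KZ.IntegralRep.slab`). Adapted from the lead's `Lines/Sketch.lean`.
[cite: KontsevichZagier2001, §1.2 rule (3)] -/
theorem liftCube_succ (N : ℕ) (t : IntegralRep N)
    (ht : t.domain = Set.pi Set.univ (fun _ : Fin N => Set.Icc (0:ℝ) 1)) :
    ∃ t' : IntegralRep (N + 1), t'.domain = Set.pi Set.univ (fun _ : Fin (N + 1) => Set.Icc (0:ℝ) 1) ∧
      (∀ x ∈ Set.pi Set.univ (fun _ : Fin (N + 1) => Set.Icc (0:ℝ) 1),
        t'.integrand x = t.integrand (Fin.init x)) ∧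
      of t - of t' ∈ relations := by
  have hdom : (t.slab 0).domain = Set.pi Set.univ (fun _ : Fin (N + 1) => Set.Icc (0:ℝ) 1) := by
    ext z
    simp only [IntegralRep.domain_slab, IntegralRep.slabDomain, ht, Nat.cast_zero, zero_add,
      mem_setOf_eq, mem_pi, mem_univ, true_implies, mem_Icc]
    constructor
    · rintro ⟨h1, h2, h3⟩ i
      refine Fin.lastCases ?_ (fun j => ?_) i
      · exact ⟨h2, h3⟩
      · simpa [Fin.init] using h1 j
    · intro hz
      exact ⟨fun j => by simpa [Fin.init] using hz (Fin.castSucc j), (hz (Fin.last N)).1,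
        (hz (Fin.last N)).2⟩
  obtain ⟨t', ht'd, ht'i, hrel⟩ := exists_domain_eq (t.slab 0) hdom
  refine ⟨t', ht'd, fun x _ => by rw [ht'i]; rfl, ?_⟩
  have h1 : of (t.slab 0) - of t ∈ relations :=
    newtonLeibnizRel_subset_relations (t.of_slab_sub_of_mem_newtonLeibnizRel 0)
  have : of t - of t' = -(of (t.slab 0) - of t) + (of (t.slab 0) - of t') := by abel
  rw [this]
  exact relations.add_mem (relations.neg_mem h1) hrel

/-- **Lifting a cube representation to any higher dimension**: `[□ᴺ, f] ∼ [□ᴹ, f ∘ pr]` for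
`N ≤ M`, `pr` the projection to the first `N` coordinates. Adapted from the lead's
`Lines/Sketch.lean`. [cite: KontsevichZagier2001, §1.2 rule (3)] -/
theorem liftCube (N M : ℕ) (hNM : N ≤ M) (t : IntegralRep N)
    (ht : t.domain = Set.pi Set.univ (fun _ : Fin N => Set.Icc (0:ℝ) 1)) :
    ∃ t' : IntegralRep M, t'.domain = Set.pi Set.univ (fun _ : Fin M => Set.Icc (0:ℝ) 1) ∧
      (∀ x ∈ Set.pi Set.univ (fun _ : Fin M => Set.Icc (0:ℝ) 1),
        t'.integrand x = t.integrand (fun l => x (Fin.castLE hNM l))) ∧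
      of t - of t' ∈ relations := by
  obtain ⟨d, rfl⟩ := Nat.exists_eq_add_of_le hNM
  induction d with
  | zero =>
    refine ⟨t, ht, fun x _ => ?_, by simp [relations.zero_mem]⟩
    rfl
  | succ d ih =>
    obtain ⟨t₁, ht₁d, ht₁i, ht₁r⟩ := ih (Nat.le_add_right N d)
    obtain ⟨t₂, ht₂d, ht₂i, ht₂r⟩ := liftCube_succ (N + d) t₁ ht₁d
    refine ⟨t₂, ht₂d, fun x hx => ?_, ?_⟩
    · rw [ht₂i x hx, ht₁i (Fin.init x) (fun j _ => hx (Fin.castSucc j) (mem_univ _))]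
      rfl
    · have : of t - of t₂ = (of t - of t₁) + (of t₁ - of t₂) := by abel
      rw [this]
      exact relations.add_mem ht₁r ht₂r

/-! ## The composition -/

/-- **Decomposition theorem.** `S1 → S2 → S3 → StokesGeneration`: `eval x = 0` ⇒ (S1)
`x ≡ [□ᴹ, h]`, `h` bounded, and by soundness `∫_{□ᴹ} h = 0` ⇒ (S2) on `□^{M'}`,
`h ∘ pr = Σⱼ (Dⱼ − Gⱼ|₁ + Gⱼ|₀)` off a null semialgebraic `Z` ⇒ (`liftCube`, null-set excision)
`x ≡ Σⱼ [□^{M'}, Dⱼ − Gⱼ|₁ + Gⱼ|₀]` ⇒ (S3) each summand is a relation ⇒ `x ∈ relations ≤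
relations ⊔ closure S`. [cite: KontsevichZagier2001, §1.2 Conjecture 1] -/
theorem StokesGeneration_of_subs :
    CubifyKernel → FibrewiseStokesGeneration → FibrewiseStokesCalibration →
      Summit.KontsevichZagierPeriods.KontsevichZagierPeriods.Theses.UnfoldedStokes.StokesGeneration := by
  classical
  intro h1 h2 h3 x hx
  refine AddSubgroup.mem_sup_left ?_
  -- (S1) one cube representation
  obtain ⟨M, t, htd, htB, hxt⟩ := h1 x
  -- its value vanishes, by soundness
  have hval : t.value = 0 := by
    have h0 := relations_le_ker_eval_holds hxt
    rwa [AddMonoidHom.mem_ker, map_sub, hx, zero_sub, neg_eq_zero, eval_of] at h0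
  -- (S2) fibrewise type-(a) decomposition on a bigger cube
  obtain ⟨M', hMM', J, i, G, D, K, q, Z, hpack, hq, hZs, hZ0, hident⟩ := h2 M t htd htB hval
  -- lift `t` to dimension `M'`
  obtain ⟨t'', ht''d, ht''i, hlift⟩ := liftCube M M' hMM' t htd
  -- `[t''] ≡ Σⱼ [q j]` off the null set `Z`
  have hsum : of t'' - ∑ j, of (q j) ∈ relations := by
    refine of_sub_sum_mem_relations_of_eqOn_off_null t'' q Z hZs hZ0
      (fun j => by rw [(hq j).1, ht''d]) ?_
    intro z hz hzZ
    rw [ht''d] at hz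
    rw [ht''i z hz, hident z hz hzZ]
  -- (S3) each summand is a relation
  have hqrel : ∑ j, of (q j) ∈ relations :=
    AddSubgroup.sum_mem _ fun j _ =>
      h3 M' (i j) (G j) (D j) (K j) (hpack j).1 (hpack j).2.1 (hpack j).2.2.1 (hpack j).2.2.2.1
        (hpack j).2.2.2.2.1 (hpack j).2.2.2.2.2.1 (hpack j).2.2.2.2.2.2 (q j) (hq j).1 (hq j).2
  have e : x = (x - of t) + (of t - of t'') + (of t'' - ∑ j, of (q j)) + ∑ j, of (q j) := by abel
  rw [e]
  exact relations.add_mem (relations.add_mem (relations.add_mem hxt hlift) hsum) hqrel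

/-- **The crux from the three registered stubs.** [cite: KontsevichZagier2001, §1.2 Conjecture 1] -/
theorem StokesGeneration_of :
    Summit.KontsevichZagierPeriods.KontsevichZagierPeriods.Theses.UnfoldedStokes.StokesGeneration :=
  StokesGeneration_of_subs stub_cubifyKernel stub_fibrewiseStokesGeneration stub_fibrewiseStokesCalibration

/-! ## Calibration of the residual (sorry-free remarks) -/

/-- **The residual implies the summit** (with S1 and S3): `S2` is of summit strength — as every
honest residual of this crux must be (`Negative/IffSummit.lean`). [cite: KontsevichZagier2001, §1.2] -/
theorem summit_of_subs (h1 : CubifyKernel) (h2 : FibrewiseStokesGeneration) (h3 : FibrewiseStokesCalibration) :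
    _root_.KontsevichZagierPeriods := by
  have hS := StokesGeneration_of_subs h1 h2 h3
  -- crux ⇒ kernel conjecture (part A landed) ⇒ summit
  refine KontsevichZagierPeriods_iff.mpr (kzKernelConjecture_iff_isRational.mp ?_)
  intro x hx
  have hmem := hS x hx
  have hsub : ∀ (A B : AddSubgroup FormalRep), B ≤ A → ∀ y, y ∈ A ⊔ B → y ∈ A :=
    fun A B hle y hy => (sup_le le_rfl hle) hy
  refine hsub _ _ ((AddSubgroup.closure_le _).mpr ?_) _ hmem
  rintro d ⟨U, a, b, c, e, rB, rR, rT, rL, rW, rD, hUo, hUI, hUs, ha, hb, hc, he, hcl, sa, sb, sc,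
    se, sa0, sa1, sb1, sc1, se0, hBd, hBi, hRd, hRi, hTd, hTi, hLd, hLi, hWd, hWi, hDd, hDi, rfl⟩
  exact Summit.KontsevichZagierPeriods.UnfoldedStokes.UnfoldedStokesSquare.unfoldedStokesSquare_proof
    U a b c e hUo hUI hUs ha hb hc he hcl sa sb sc se sa0 sa1 sb1 sc1 se0 rB rR rT rL rW rD
    hBd hBi hRd hRi hTd hTi hLd hLi hWd hWi hDd hDi

end Summit.KontsevichZagierPeriods.KontsevichZagierPeriods.Cruxes.StokesGeneration.FibrewiseStokes
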